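import Literature.Analysis.FluidPDE.DissipationAnomalyProofs
import Literature.Analysis.FluidPDE.DuchonRobert
import Literature.Analysis.FluidPDE.DuchonRobertShellLaw
import Literature.Analysis.FunctionSpaces.FlatTorusProofs
import Literature.Analysis.FunctionSpaces.TorusSpaceTime
import HarnessLib

/-!
# Duchon–Robert's inviscid limit: the dissipation measure is the defect of the limit

`Literature.Analysis.FluidPDE.DissipationAnomaly` records as a named fact
`Torus.IsDissipationMeasureOf.hasDuchonRobertDefect` the content of Duchon–Robert 2000,
Prop. 4 (p. 253) — precisely, of the displayed identity in its proof, "Since `u^ν` tends to `u`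
in `L³(0,T;L³)` strong, one has `lim_{ν→0} (ν(∇u^ν)² + D(u^ν)) = −∂ₜ(½u²) − div((½u² + p)u) = D(u)`
in the sense of distributions" — specialised to defect-free approximants: if unforced Leray–Hopf solutions `u_m`
of Navier–Stokes on `T^d × [0,T)` with viscosities `ν_m → 0⁺` and zero Duchon–Robert defect
converge to `u` strongly in `L³((0,T) × T^d)`, then any weak limit `D` of the dissipation
measures `ν_m |∇u_m|² dx dt` represents the Duchon–Robert defect of the limit:
`∫ ψ dD = D(u)(ψ)` for test functions supported in `(0, T)`.

This file **decomposes** that fact along the printed proof (Duchon–Robert 2000, proof of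
Prop. 4; reproduced in Drivas–Eyink 2019, §2, proof of Thm. 2) and proves everything except
the pressure estimate, which is recorded as one named sub-fact:

* `Torus.isWeakEulerSolutionOn_of_inviscidLimit` (**proved**) — strong `L²_{t,x}` inviscid
  limits of pressure-free weak Navier–Stokes solutions are weak Euler solutions (Drivas–Eyink
  2019, Thm. 2(ii) and its proof; DiPerna–Majda 1987, §1): weak divergence-freeness passes to
  the limit along an a.e.-convergent subsequence of slices
  (`Torus.ae_isWeaklyDivFree_of_tendsto_lintegral`), and the weak momentum equation passes to
  the limit by Cauchy–Schwarz (`Torus.lintegral_enorm_momentumFlux_sub_le`);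
* `Torus.exists_pressure_of_tendsto_L3` (**named fact**) — the pressure of `L³` weak solutions
  on the torus is an `L^{3/2}` function making the equations hold against all vector tests, and
  it depends continuously (in `L^{3/2}_{t,x}`) on `u` in `L³_{t,x}` (Duchon–Robert 2000, proof
  of Prop. 1; Robinson–Rodrigo–Sadowski 2016, Lemma 5.1 (5.7) and Prop. 5.3: Calderón–Zygmund);
* `Torus.tendsto_energyFlux_of_tendsto_L3` (**proved**) — the local energy flux pairing
  `∫∫ [½|u|²∂ₜψ + (½|u|² + p)⟪u,∇ψ⟫ + ½ν|u|²Δψ]` is continuous along `u_m → u` in `L³`,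
  `p_m → p` in `L^{3/2}`, `ν_m → 0` (the limit passage of the proof of Prop. 4; Drivas–Eyink
  2019, proof of Thm. 2(ii), bounds (b1)–(b3) and `|J⁰_ℓ| ≲ ‖u‖₃³ + ‖p‖_{3/2}‖u‖₃`): pointwise
  algebra and Hölder `3/2, 3` term by term (`Torus.lintegral_enorm_energyFlux_sub_le`);

together with the two facts already in the tree that the proof consumes:

* `Turb.duchon_robert_defect_exists` (Duchon–Robert 2000, Prop. 2 and (10): existence of the
  defect `D(u)` and the local energy balance for `L³` distributional Navier–Stokes / Euler
  solutions), used twice — for each `u_m` (where the balance and `D(u_m) = 0` identify the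
  energy flux of `u_m` with `∫ ψ ν_m|∇u_m|²`) and for the limit `(u, p)` (where it produces
  `D(u)` and identifies `D(u)(ψ)` with the limit flux);
* `Torus.HasWeakGradient.unique` (Evans 2010, §5.2.1: integrable weak gradients are a.e.
  unique), to identify the gradient witness of the local balance with the one carried by the
  dissipation measure.

The assembly is `Torus.IsDissipationMeasureOf.hasDuchonRobertDefect_of` (hypotheses: the
pressure fact, Duchon–Robert's Prop. 2, uniqueness of weak gradients); once these three facts
are discharged, `hasDuchonRobertDefect_holds` is a one-liner. The glue proved here (all
[folklore]): Tonelli/Fubini bookkeeping on `(0,T) × T^d`, `L³ ⊂ L²` by Hölder, the guarded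
mixed classes `MemLqLp r r` from joint `L^r` bounds, a.e.-convergent subsequences from
`∫⁻ g_m → 0` (`Torus.exists_subseq_tendsto_ae_of_tendsto_lintegral`), integrability of the
energy-flux integrand (Hölder `3/2, 3`), the pairing `∫ ψ d(ν|G|² dx dt) = ∫₀ᵀ∫ ν|G|²ψ`, and
the key identity `Torus.energyFlux_eq_integral_dissipationMeasure` for one defect-free solution.

## Design notes

* The sub-fact and the two limit theorems are stated, like the target, with joint lower
  Lebesgue integrals `∫⁻ t in Ioo 0 T, ∫⁻ x, ‖·‖ₑ ^ r` and measurability of the space–time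
  lift `stLift`; the
  conversion to the guarded mixed classes `Torus.MemLqLp` consumed by
  `Turb.duchon_robert_defect_exists` is proved (`Torus.memLqLp_of_lintegral_lt_top`).
* The target carries no uniform energy bound on the data `u₀^m`, so the weak-* wrapper
  `Turb.weakLimit_isWeakEuler_of_strong` (which asks for `Torus.TendstoWeakStar`) is not
  applicable; `isWeakEulerSolutionOn_of_inviscidLimit` is the hypothesis-minimal form (strong
  `L²_{t,x}` convergence only), which is what the printed argument uses.
* Properties of the approximants are only needed *eventually* (`∀ᶠ m in atTop`): the target's
  `Tendsto νseq atTop (𝓝[>] 0)` makes `ν_m > 0` only eventually, and `u_m ∈ L³_{t,x}` follows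
  from the convergence only eventually (`eventually_lintegral_enorm_pow_three_lt_top`).
* For `T ≤ 0` every test function supported in `(0, T)` vanishes identically
  (`IsSpaceTimeTestIoo.eq_zero_of_nonpos`) and the target is trivial.

## Sources read

* T. D. Drivas, G. L. Eyink, *An Onsager singularity theorem for Leray solutions of
  incompressible Navier–Stokes*, Nonlinearity 32 (2019), arXiv:1710.05205: Thm. 2 (PDF p. 5),
  §2 proofs (PDF pp. 8–11): the local balance (DRloc) of Leray solutions with
  `ε[u^ν] = ν|∇u^ν|² + D[u^ν]`, `p^ν ∈ L^{3/2}` "see e.g. Proposition 1 of [DR00]", the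
  Calderón–Zygmund continuity `u ⊗ u ↦ p` in `L^p`, and "for any such subsequence
  [`u^{ν_k} → u` strongly in `L³`], we can apply the arguments of [DR00] to obtain …
  `D[u] = lim_{ν → 0} ε[u^ν]`". [DrivasEyink2019]
* J. C. Robinson, J. L. Rodrigo, W. Sadowski, *The Three-Dimensional Navier–Stokes Equations*,
  CUP 2016, Ch. 5, PDF pp. 87–90: Lemma 5.1 ((5.6)–(5.8), `‖p‖_{L^r} ≤ C_r ‖u‖²_{L^{2r}}` on
  `𝕋³`, zero-mean normalisation), Prop. 5.3 ((5.17)–(5.18), the equations hold in the sense of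
  space–time distributions with this pressure, via the Helmholtz–Weyl decomposition of the test
  field). [RobinsonRodrigoSadowski2016]
* J. Duchon, R. Robert, *Inertial energy dissipation for weak solutions of incompressible Euler
  and Navier–Stokes equations*, Nonlinearity 13 (2000) 249–255, read in full: Prop. 1 (p. 250:
  for a weak Navier–Stokes solution `u ∈ L²(0,T;H¹) ∩ L^∞(0,T;L²)` on `T³` the functions
  `D_ε(u) = ¼∫∇φ^ε(ξ)·δu(δu)² dξ` converge in `𝒟'(]0,T[×T)` to `D(u)`, not depending on `φ`,
  and `∂ₜ(½u²) + div(u(½u² + p)) − νΔ½u² + ν(∇u)² + D(u) = 0`; proof, pp. 250–251: "the linear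
  operator `uᵢuₖ → p` is strongly continuous on `L^q` for `1 < q < ∞`, and so
  `p ∈ L^{3/2}(0,T;L^{3/2})`"), Prop. 2 (p. 251: the same for weak Euler solutions
  `u ∈ L³(0,T;L³)`), Prop. 4 (p. 253: "Let `u ∈ L³(0,T;L³)` be a weak solution of the Euler
  equation, which is the strong limit of a sequence of dissipative weak solutions of
  Navier–Stokes as viscosity goes to zero. Then `D(u) ≥ 0`") and its four-line proof quoted
  above. The journal version numbers only equation (1); the locators "(6)–(10)", "(15)" in the
  docstrings of `DissipationAnomaly` / `DuchonRobert` refer to a differently numbered version of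
  the same displays, so this file cites by proposition and page. [DuchonRobert2000]
* L. C. Evans, *Partial Differential Equations*, 2nd ed. (2010), §5.2.1. [Evans2010]
-/

noncomputable section

open MeasureTheory TopologicalSpace Set Function Filter Topology Metric
open scoped InnerProductSpace RealInnerProductSpace ENNReal NNReal BoundedContinuousFunction

namespace Literature.Analysis.FluidPDE.Torus

variable {d : Type*} [Fintype d]
variable {T : ℝ} {u : ℝ → UnitAddTorus d → EuclideanSpace ℝ d}

/-! ## The named sub-fact: the pressure -/

/-- **The pressure of `L³` weak solutions on the torus and its continuity** (Duchon–Robert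
2000, Prop. 1; Robinson–Rodrigo–Sadowski 2016, Lemma 5.1, (5.7): on `𝕋³` the zero-mean solution
of `−Δp = ∂ᵢ∂ⱼ(uᵢuⱼ)` satisfies `‖p‖_{L^r} ≤ C_r ‖u‖²_{L^{2r}}`, `1 < r < ∞`, by the
Calderón–Zygmund theorem, and Prop. 5.3: with this pressure a weak solution satisfies the
equations in the sense of space–time distributions, i.e. against *all* smooth vector test
fields, via the Helmholtz–Weyl decomposition of the test field). Sequential form consumed by
Duchon–Robert's Prop. 4: if `u_m` (eventually) and `u` are pressure-free weak solutions on
`T^d × (0,T)` (`Torus.IsWeakNSSolutionOn`, any viscosities) with `u ∈ L³_{t,x}` and `u_m → u` in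
`L³((0,T) × T^d)`, then there are pressures `p_m, p ∈ L^{3/2}((0,T) × T^d)` such that
`(u_m, p_m)` (eventually) and `(u, p)` are distributional solutions
(`Torus.IsDistributionalNSSolutionOn`, unforced) and `p_m → p` in `L^{3/2}((0,T) × T^d)`
(`p_m − p = RᵢRⱼ(uᵢ^m uⱼ^m − uᵢuⱼ)` and `‖u_m ⊗ u_m − u ⊗ u‖_{3/2} ≤ (‖u_m‖₃ + ‖u‖₃)‖u_m − u‖₃`).
The printed statements are three-dimensional; the Fourier-multiplier proof is dimensionless. [cite: DuchonRobert2000, proof of Prop. 1 pp. 250–251] [cite: RobinsonRodrigoSadowski2016, Lemma 5.1 and Prop. 5.3] -/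
def exists_pressure_of_tendsto_L3 : Prop :=
  ∀ [DecidableEq d] {νseq : ℕ → ℝ} {ν : ℝ} {useq : ℕ → ℝ → UnitAddTorus d → EuclideanSpace ℝ d}
    (hsol : ∀ᶠ m in atTop, FunctionSpaces.Torus.IsWeakNSSolutionOn T (νseq m) (useq m))
    (hu : FunctionSpaces.Torus.IsWeakNSSolutionOn T ν u)
    (hconv : Tendsto (fun m => ∫⁻ t in Ioo 0 T, ∫⁻ x, ‖useq m t x - u t x‖ₑ ^ (3 : ℕ)) atTop (𝓝 0))
    (hu3 : ∫⁻ t in Ioo 0 T, ∫⁻ x, ‖u t x‖ₑ ^ (3 : ℕ) < ∞),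
    ∃ (pseq : ℕ → ℝ → UnitAddTorus d → ℝ) (p : ℝ → UnitAddTorus d → ℝ),
      (∀ᶠ m in atTop, IsDistributionalNSSolutionOn T (νseq m) 0 (useq m) (pseq m) ∧
        ∫⁻ t in Ioo 0 T, ∫⁻ x, ‖pseq m t x‖ₑ ^ (3 / 2 : ℝ) < ∞) ∧
      IsDistributionalNSSolutionOn T ν 0 u p ∧
      ∫⁻ t in Ioo 0 T, ∫⁻ x, ‖p t x‖ₑ ^ (3 / 2 : ℝ) < ∞ ∧
      Tendsto (fun m => ∫⁻ t in Ioo 0 T, ∫⁻ x, ‖pseq m t x - p t x‖ₑ ^ (3 / 2 : ℝ)) atTop (𝓝 0)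

/-! ## Measure-theoretic glue on `(0, T) × T^d` -/

section Glue

variable {F : Type*} [NormedAddCommGroup F]

/-- `dt dx ⌊ ((0,T) × T^d)` is the product of `dt ⌊ (0, T)` with `dx`. [folklore] -/
theorem volume_restrict_Ioo_prod_univ (T : ℝ) :
    (volume.restrict (Ioo 0 T ×ˢ (univ : Set (UnitAddTorus d))) : Measure (ℝ × UnitAddTorus d)) =
      (volume.restrict (Ioo 0 T)).prod volume := by
  rw [Measure.volume_eq_prod, ← Measure.prod_restrict, Measure.restrict_univ]

/-- `dt dx ⌊ ([0,T] × T^d) = dt dx ⌊ ((0,T) × T^d)` (the time slices `{0, T}` are Lebesgue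
null). [folklore] -/
theorem volume_restrict_Icc_prod_univ (T : ℝ) :
    (volume.restrict (Icc 0 T ×ˢ (univ : Set (UnitAddTorus d))) : Measure (ℝ × UnitAddTorus d)) =
      (volume.restrict (Ioo 0 T)).prod volume := by
  rw [Measure.volume_eq_prod, ← Measure.prod_restrict, Measure.restrict_univ,
    ← restrict_Ioo_eq_restrict_Icc]

/-- Joint measurability on `(0,T) × T^d` (product form) from measurability of the space–time
lift (`Torus.aestronglyMeasurable_uncurry_of_stLift_restrict`). [folklore] -/
theorem aestronglyMeasurable_uncurry_prod {G : Type*} [TopologicalSpace G]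
    {f : ℝ → UnitAddTorus d → G}
    (hf : AEStronglyMeasurable (FunctionSpaces.Torus.stLift f) (volume.restrict (Ioo 0 T ×ˢ univ))) :
    AEStronglyMeasurable (uncurry f) ((volume.restrict (Ioo 0 T)).prod volume) := by
  rw [← volume_restrict_Ioo_prod_univ]
  exact FunctionSpaces.Torus.aestronglyMeasurable_uncurry_of_stLift_restrict hf

/-- Tonelli on `(0,T) × T^d`: iterated lower integrals are product lower integrals. [folklore] -/
theorem lintegral_Ioo_lintegral_eq_lintegral_prod {g : ℝ → UnitAddTorus d → ℝ≥0∞}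
    (hg : AEMeasurable (uncurry g) ((volume.restrict (Ioo 0 T)).prod volume)) :
    ∫⁻ t in Ioo 0 T, ∫⁻ x, g t x = ∫⁻ z, g z.1 z.2 ∂((volume.restrict (Ioo 0 T)).prod volume) :=
  (lintegral_prod (uncurry g) hg).symm

/-- The total mass of `dt dx ⌊ ((0,T) × T^d)` is `T` (the torus has volume one). [folklore] -/
theorem prod_Ioo_univ (T : ℝ) :
    ((volume.restrict (Ioo 0 T)).prod (volume : Measure (UnitAddTorus d))) univ =
      ENNReal.ofReal T := by
  rw [← univ_prod_univ, Measure.prod_prod, Measure.restrict_apply_univ, Real.volume_Ioo,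
    measure_univ, mul_one, sub_zero]

/-- **`L³ ⊂ L²` on `(0,T) × T^d`** (Hölder with exponents `3/2, 3` against `1`):
`∫∫ ‖f‖² ≤ T^{1/3} (∫∫ ‖f‖³)^{2/3}`. [folklore] -/
theorem lintegral_enorm_sq_le {f : ℝ → UnitAddTorus d → F}
    (hf : AEStronglyMeasurable (uncurry f) ((volume.restrict (Ioo 0 T)).prod volume)) :
    ∫⁻ t in Ioo 0 T, ∫⁻ x, ‖f t x‖ₑ ^ 2 ≤
      ENNReal.ofReal T ^ (1 / 3 : ℝ) * (∫⁻ t in Ioo 0 T, ∫⁻ x, ‖f t x‖ₑ ^ (3 : ℕ)) ^ (2 / 3 : ℝ) := by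
  set μT := (volume.restrict (Ioo 0 T)).prod (volume : Measure (UnitAddTorus d)) with hμT
  have h2 : AEMeasurable (uncurry fun t x => ‖f t x‖ₑ ^ 2) μT := hf.enorm.pow_const _
  have h3 : AEMeasurable (uncurry fun t x => ‖f t x‖ₑ ^ (3 : ℕ)) μT :=
    hf.enorm.pow_const _
  have e2 : ∫⁻ t in Ioo 0 T, ∫⁻ x, ‖f t x‖ₑ ^ 2 = ∫⁻ z, ‖f z.1 z.2‖ₑ ^ 2 ∂μT :=
    lintegral_Ioo_lintegral_eq_lintegral_prod h2
  have e3 : ∫⁻ t in Ioo 0 T, ∫⁻ x, ‖f t x‖ₑ ^ (3 : ℕ) = ∫⁻ z, ‖f z.1 z.2‖ₑ ^ (3 : ℕ) ∂μT :=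
    lintegral_Ioo_lintegral_eq_lintegral_prod h3
  rw [e2, e3]
  have hH : Real.HolderConjugate (3 / 2 : ℝ) 3 := ⟨by norm_num, by norm_num, by norm_num⟩
  have hpt : ∀ x : ℝ≥0∞, (x ^ 2) ^ (3 / 2 : ℝ) = x ^ (3 : ℕ) := fun x => by
    rw [← ENNReal.rpow_natCast x 2, ← ENNReal.rpow_mul, ← ENNReal.rpow_natCast x 3]
    norm_num
  have h := ENNReal.lintegral_mul_le_Lp_mul_Lq μT hH
    (f := fun z => ‖f z.1 z.2‖ₑ ^ 2) (g := fun _ => 1) h2 aemeasurable_const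
  simp only [Pi.mul_apply, mul_one, ENNReal.one_rpow, lintegral_const, one_mul, hpt] at h
  rw [prod_Ioo_univ, mul_comm] at h
  convert h using 2
  norm_num

/-- `L³` convergence on `(0,T) × T^d` implies `L²` convergence (`lintegral_enorm_sq_le`). [folklore] -/
theorem tendsto_lintegral_enorm_sq {fseq : ℕ → ℝ → UnitAddTorus d → F}
    (hf : ∀ᶠ m in atTop,
      AEStronglyMeasurable (uncurry (fseq m)) ((volume.restrict (Ioo 0 T)).prod volume))
    (h3 : Tendsto (fun m => ∫⁻ t in Ioo 0 T, ∫⁻ x, ‖fseq m t x‖ₑ ^ (3 : ℕ)) atTop (𝓝 0)) :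
    Tendsto (fun m => ∫⁻ t in Ioo 0 T, ∫⁻ x, ‖fseq m t x‖ₑ ^ 2) atTop (𝓝 0) := by
  have hb : Tendsto (fun m => ENNReal.ofReal T ^ (1 / 3 : ℝ) *
      (∫⁻ t in Ioo 0 T, ∫⁻ x, ‖fseq m t x‖ₑ ^ (3 : ℕ)) ^ (2 / 3 : ℝ)) atTop (𝓝 0) := by
    have h1 : Tendsto (fun m => (∫⁻ t in Ioo 0 T, ∫⁻ x, ‖fseq m t x‖ₑ ^ (3 : ℕ)) ^ (2 / 3 : ℝ))
        atTop (𝓝 0) := by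
      have := ((ENNReal.continuous_rpow_const (y := (2 / 3 : ℝ))).tendsto 0).comp h3
      rwa [ENNReal.zero_rpow_of_pos (by norm_num)] at this
    have h2 := ENNReal.Tendsto.const_mul h1 (a := ENNReal.ofReal T ^ (1 / 3 : ℝ))
      (Or.inr (ENNReal.rpow_ne_top_of_nonneg (by norm_num) ENNReal.ofReal_ne_top))
    rwa [mul_zero] at h2
  refine tendsto_of_tendsto_of_tendsto_of_le_of_le' tendsto_const_nhds hb
    (Eventually.of_forall fun _ => zero_le) ?_
  filter_upwards [hf] with m hm
  exact lintegral_enorm_sq_le hm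

/-- A jointly measurable field on `(0,T) × T^d` with `∫∫ ‖f‖^r < ∞` lies in the (guarded) mixed
class `L^r(0,T; L^r(T^d))` (`Torus.MemLqLp r r`; Fubini–Tonelli). [folklore] -/
theorem memLqLp_of_lintegral_lt_top {r : ℝ≥0∞} (hr0 : r ≠ 0) (hrtop : r ≠ ∞)
    {f : ℝ → UnitAddTorus d → F}
    (hf : AEStronglyMeasurable (uncurry f) ((volume.restrict (Ioo 0 T)).prod volume))
    (hfin : ∫⁻ t in Ioo 0 T, ∫⁻ x, ‖f t x‖ₑ ^ r.toReal < ∞) : MemLqLp r r f (Ioo 0 T) := by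
  have hslice : ∀ᵐ t ∂(volume.restrict (Ioo 0 T)), AEStronglyMeasurable (f t) volume :=
    hf.prodMk_left
  have hint : AEMeasurable (fun t => ∫⁻ x, ‖f t x‖ₑ ^ r.toReal) (volume.restrict (Ioo 0 T)) :=
    (hf.enorm.pow_const _).lintegral_prod_right'
  have hfin' : ∀ᵐ t ∂(volume.restrict (Ioo 0 T)), ∫⁻ x, ‖f t x‖ₑ ^ r.toReal < ∞ :=
    ae_lt_top' hint hfin.ne
  have hmem : ∀ᵐ t ∂(volume.restrict (Ioo 0 T)), MemLp (f t) r volume := by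
    filter_upwards [hslice, hfin'] with t h1 h2
    exact ⟨h1, (eLpNorm_lt_top_iff_lintegral_rpow_enorm_lt_top hr0 hrtop).2 h2⟩
  refine ⟨hmem, ?_⟩
  change eLpNorm (fun t => (eLpNorm (f t) r volume).toReal) r (volume.restrict (Ioo 0 T)) < ∞
  rw [eLpNorm_lt_top_iff_lintegral_rpow_enorm_lt_top hr0 hrtop]
  have hr : 0 < r.toReal := ENNReal.toReal_pos hr0 hrtop
  have hkey : ∀ᵐ t ∂(volume.restrict (Ioo 0 T)),
      ‖(eLpNorm (f t) r volume).toReal‖ₑ ^ r.toReal = ∫⁻ x, ‖f t x‖ₑ ^ r.toReal := by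
    filter_upwards [hmem] with t ht
    rw [Real.enorm_eq_ofReal ENNReal.toReal_nonneg, ENNReal.ofReal_toReal ht.eLpNorm_ne_top,
      eLpNorm_eq_lintegral_rpow_enorm_toReal hr0 hrtop, ← ENNReal.rpow_mul,
      one_div_mul_cancel hr.ne', ENNReal.rpow_one]
  rw [lintegral_congr_ae hkey]
  exact hfin

/-- `u_m → u` in `L³_{t,x}` and `u ∈ L³_{t,x}` give `u_m ∈ L³_{t,x}` eventually
(`‖a‖³ ≤ 4 (‖a - b‖³ + ‖b‖³)`). [folklore] -/
theorem eventually_lintegral_enorm_pow_three_lt_top {useq : ℕ → ℝ → UnitAddTorus d → F}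
    {v : ℝ → UnitAddTorus d → F}
    (hmeas_seq : ∀ᶠ m in atTop,
      AEStronglyMeasurable (uncurry (useq m)) ((volume.restrict (Ioo 0 T)).prod volume))
    (hmeas : AEStronglyMeasurable (uncurry v) ((volume.restrict (Ioo 0 T)).prod volume))
    (hconv : Tendsto (fun m => ∫⁻ t in Ioo 0 T, ∫⁻ x, ‖useq m t x - v t x‖ₑ ^ (3 : ℕ)) atTop (𝓝 0))
    (hv3 : ∫⁻ t in Ioo 0 T, ∫⁻ x, ‖v t x‖ₑ ^ (3 : ℕ) < ∞) :
    ∀ᶠ m in atTop, ∫⁻ t in Ioo 0 T, ∫⁻ x, ‖useq m t x‖ₑ ^ (3 : ℕ) < ∞ := by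
  set μT := (volume.restrict (Ioo 0 T)).prod (volume : Measure (UnitAddTorus d)) with hμT
  have hfin : ∀ᶠ m in atTop, ∫⁻ t in Ioo 0 T, ∫⁻ x, ‖useq m t x - v t x‖ₑ ^ (3 : ℕ) < ∞ :=
    hconv.eventually (eventually_lt_nhds ENNReal.zero_lt_top)
  filter_upwards [hmeas_seq, hfin] with m hm hfm
  have hdiff : AEStronglyMeasurable (fun z : ℝ × UnitAddTorus d => useq m z.1 z.2 - v z.1 z.2) μT :=
    hm.sub hmeas
  have e1 : ∫⁻ t in Ioo 0 T, ∫⁻ x, ‖useq m t x‖ₑ ^ (3 : ℕ) = ∫⁻ z, ‖useq m z.1 z.2‖ₑ ^ (3 : ℕ) ∂μT :=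
    lintegral_Ioo_lintegral_eq_lintegral_prod (hm.enorm.pow_const _)
  have e2 : ∫⁻ t in Ioo 0 T, ∫⁻ x, ‖useq m t x - v t x‖ₑ ^ (3 : ℕ) =
      ∫⁻ z, ‖useq m z.1 z.2 - v z.1 z.2‖ₑ ^ (3 : ℕ) ∂μT :=
    lintegral_Ioo_lintegral_eq_lintegral_prod (hdiff.enorm.pow_const _)
  have e3 : ∫⁻ t in Ioo 0 T, ∫⁻ x, ‖v t x‖ₑ ^ (3 : ℕ) = ∫⁻ z, ‖v z.1 z.2‖ₑ ^ (3 : ℕ) ∂μT :=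
    lintegral_Ioo_lintegral_eq_lintegral_prod (hmeas.enorm.pow_const _)
  rw [e1]
  rw [e2] at hfm
  rw [e3] at hv3
  have hpt : ∀ z : ℝ × UnitAddTorus d, ‖useq m z.1 z.2‖ₑ ^ (3 : ℕ) ≤
      2 ^ (2 : ℝ) * (‖useq m z.1 z.2 - v z.1 z.2‖ₑ ^ (3 : ℕ) + ‖v z.1 z.2‖ₑ ^ (3 : ℕ)) := by
    intro z
    have htri : ‖useq m z.1 z.2‖ₑ ≤ ‖useq m z.1 z.2 - v z.1 z.2‖ₑ + ‖v z.1 z.2‖ₑ := by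
      calc ‖useq m z.1 z.2‖ₑ = ‖(useq m z.1 z.2 - v z.1 z.2) + v z.1 z.2‖ₑ := by
            rw [sub_add_cancel]
        _ ≤ _ := enorm_add_le _ _
    have h := ENNReal.rpow_add_le_mul_rpow_add_rpow (‖useq m z.1 z.2 - v z.1 z.2‖ₑ)
      (‖v z.1 z.2‖ₑ) (p := 3) (by norm_num)
    rw [← ENNReal.rpow_natCast, ← ENNReal.rpow_natCast, ← ENNReal.rpow_natCast]
    push_cast
    refine (ENNReal.rpow_le_rpow htri (by norm_num)).trans (h.trans_eq ?_)
    norm_num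
  calc ∫⁻ z, ‖useq m z.1 z.2‖ₑ ^ (3 : ℕ) ∂μT
      ≤ ∫⁻ z, 2 ^ (2 : ℝ) * (‖useq m z.1 z.2 - v z.1 z.2‖ₑ ^ (3 : ℕ) + ‖v z.1 z.2‖ₑ ^ (3 : ℕ)) ∂μT :=
        lintegral_mono hpt
    _ = 2 ^ (2 : ℝ) * ((∫⁻ z, ‖useq m z.1 z.2 - v z.1 z.2‖ₑ ^ (3 : ℕ) ∂μT) +
          ∫⁻ z, ‖v z.1 z.2‖ₑ ^ (3 : ℕ) ∂μT) := by
        rw [lintegral_const_mul' _ _ (ENNReal.rpow_ne_top_of_nonneg (by norm_num)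
          ENNReal.ofNat_ne_top), lintegral_add_left' (hdiff.enorm.pow_const _)]
    _ < ∞ := ENNReal.mul_lt_top (ENNReal.rpow_lt_top_of_nonneg (by norm_num) ENNReal.ofNat_ne_top)
          (ENNReal.add_lt_top.2 ⟨hfm, hv3⟩)

end Glue

/-! ## Space–time test fields: bounds and measurability of the derived fields -/

section TestField

variable {ψ : ℝ → UnitAddTorus d → ℝ}

/-- The fields derived from a scalar space–time test function that enter the local energy
balance — `ψ`, `∂ₜψ`, `∇ψ`, `Δψ` — are jointly smooth on `ℝ × T^d`. [folklore] -/
theorem _root_.Literature.Analysis.FunctionSpaces.Torus.IsSpaceTimeTest.isSmoothSpaceTimeOn_derived (hψ : FunctionSpaces.Torus.IsSpaceTimeTest T ψ) :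
    FunctionSpaces.Torus.IsSmoothSpaceTimeOn univ ψ ∧ FunctionSpaces.Torus.IsSmoothSpaceTimeOn univ (FunctionSpaces.Torus.timeDeriv ψ) ∧
      FunctionSpaces.Torus.IsSmoothSpaceTimeOn univ (fun t => FunctionSpaces.Torus.gradient (ψ t)) ∧
      FunctionSpaces.Torus.IsSmoothSpaceTimeOn univ (fun t => FunctionSpaces.Torus.laplacian (ψ t)) := by
  classical
  have h0 : FunctionSpaces.Torus.IsSmoothSpaceTimeOn univ ψ := hψ.isSmoothSpaceTimeOn univ
  exact ⟨h0, hψ.timeDeriv.isSmoothSpaceTimeOn univ, h0.gradient uniqueDiffOn_univ,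
    h0.laplacian uniqueDiffOn_univ⟩

/-- A jointly smooth field on `ℝ × T^d` is bounded on `[0, T] × T^d` by a nonnegative constant
and is jointly measurable on `(0,T) × T^d`. [folklore] -/
theorem _root_.Literature.Analysis.FunctionSpaces.Torus.IsSmoothSpaceTimeOn.bound_and_measurable {G : Type*} [NormedAddCommGroup G]
    [NormedSpace ℝ G] {w : ℝ → UnitAddTorus d → G} (hw : FunctionSpaces.Torus.IsSmoothSpaceTimeOn univ w) (T : ℝ) :
    (∃ C : ℝ, 0 ≤ C ∧ ∀ t ∈ Icc 0 T, ∀ x, ‖w t x‖ ≤ C) ∧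
      AEStronglyMeasurable (uncurry w) ((volume.restrict (Ioo 0 T)).prod volume) := by
  obtain ⟨C, hC⟩ := hw.exists_norm_le_of_isCompact isCompact_Icc (subset_univ _)
  refine ⟨⟨max C 0, le_max_right _ _, fun t ht x => (hC t ht x).trans (le_max_left _ _)⟩, ?_⟩
  exact aestronglyMeasurable_uncurry_prod
    (hw.aestronglyMeasurable_stLift measurableSet_Ioo (subset_univ _))

/-- For `T ≤ 0`, a test function supported in `(0, T)` vanishes identically. [folklore] -/
theorem _root_.Literature.Analysis.FunctionSpaces.Torus.IsSpaceTimeTestIoo.eq_zero_of_nonpos (hψ : FunctionSpaces.Torus.IsSpaceTimeTestIoo T ψ) (hT : T ≤ 0) (t : ℝ) :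
    ψ t = 0 := by
  obtain ⟨⟨-, T', hT', hψT'⟩, ε, hε, hψε⟩ := hψ
  by_cases ht : t ≤ ε
  · exact hψε t ht
  · exact hψT' t (by linarith [not_le.1 ht])

/-- The bounded continuous function on `ℝ × T^d` underlying a scalar test function supported in
`(0, T)` (how a test function is fed to the weak convergence of dissipation measures). [folklore] -/
def _root_.Literature.Analysis.FunctionSpaces.Torus.IsSpaceTimeTestIoo.toBCF (hψ : FunctionSpaces.Torus.IsSpaceTimeTestIoo T ψ) : (ℝ × UnitAddTorus d) →ᵇ ℝ :=
  BoundedContinuousFunction.ofNormedAddCommGroup (uncurry ψ)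
    (FunctionSpaces.Torus.continuous_uncurry_of_continuous_stLift hψ.isSpaceTimeTest.1.continuous)
    hψ.exists_abs_le.choose
    fun z => by rw [Real.norm_eq_abs]; exact hψ.exists_abs_le.choose_spec z.1 z.2

/-- `IsSpaceTimeTestIoo.toBCF` is the uncurried test function. [folklore] -/
@[simp]
theorem _root_.Literature.Analysis.FunctionSpaces.Torus.IsSpaceTimeTestIoo.toBCF_apply (hψ : FunctionSpaces.Torus.IsSpaceTimeTestIoo T ψ) (z : ℝ × UnitAddTorus d) :
    hψ.toBCF z = ψ z.1 z.2 :=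
  rfl

end TestField

/-! ## Integrability of the local energy flux and of the dissipation density -/

section Integrability

variable {v : ℝ → UnitAddTorus d → EuclideanSpace ℝ d} {q : ℝ → UnitAddTorus d → ℝ}
  {ψ : ℝ → UnitAddTorus d → ℝ}

/-- **The local energy flux integrand is integrable on `(0,T) × T^d`** for `v ∈ L³_{t,x}`,
`q ∈ L^{3/2}_{t,x}` (jointly measurable) and a test function `ψ`:
`|½|v|²∂ₜψ + (½|v|² + q)⟪v, ∇ψ⟫ + ½ν|v|²Δψ| ≲ |v|² + |v|³ + |q||v|` (Hölder `3/2, 3`). [folklore] -/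
theorem integrable_energyFluxIntegrand (ν : ℝ)
    (hv : AEStronglyMeasurable (uncurry v) ((volume.restrict (Ioo 0 T)).prod volume))
    (hv3 : ∫⁻ t in Ioo 0 T, ∫⁻ x, ‖v t x‖ₑ ^ (3 : ℕ) < ∞)
    (hq : AEStronglyMeasurable (uncurry q) ((volume.restrict (Ioo 0 T)).prod volume))
    (hq32 : ∫⁻ t in Ioo 0 T, ∫⁻ x, ‖q t x‖ₑ ^ (3 / 2 : ℝ) < ∞)
    (hψ : FunctionSpaces.Torus.IsSpaceTimeTest T ψ) :
    Integrable (fun z : ℝ × UnitAddTorus d =>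
      2⁻¹ * ‖v z.1 z.2‖ ^ 2 * FunctionSpaces.Torus.timeDeriv ψ z.1 z.2 +
        (2⁻¹ * ‖v z.1 z.2‖ ^ 2 + q z.1 z.2) * ⟪v z.1 z.2, FunctionSpaces.Torus.gradient (ψ z.1) z.2⟫ +
        2⁻¹ * ν * ‖v z.1 z.2‖ ^ 2 * FunctionSpaces.Torus.laplacian (ψ z.1) z.2)
      ((volume.restrict (Ioo 0 T)).prod volume) := by
  set μT := (volume.restrict (Ioo 0 T)).prod (volume : Measure (UnitAddTorus d)) with hμT
  -- the test-derived fields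
  obtain ⟨-, hdt, hgr, hla⟩ := hψ.isSmoothSpaceTimeOn_derived
  obtain ⟨⟨Cdt, hCdt0, hCdt⟩, hdtm⟩ := hdt.bound_and_measurable T
  obtain ⟨⟨Cgr, hCgr0, hCgr⟩, hgrm⟩ := hgr.bound_and_measurable T
  obtain ⟨⟨Cla, hCla0, hCla⟩, hlam⟩ := hla.bound_and_measurable T
  -- `v ∈ L³ ⊂ L²`, `q v ∈ L¹`
  have e3 : ∫⁻ t in Ioo 0 T, ∫⁻ x, ‖v t x‖ₑ ^ (3 : ℕ) = ∫⁻ z, ‖v z.1 z.2‖ₑ ^ (3 : ℕ) ∂μT :=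
    lintegral_Ioo_lintegral_eq_lintegral_prod (hv.enorm.pow_const _)
  have e32 : ∫⁻ t in Ioo 0 T, ∫⁻ x, ‖q t x‖ₑ ^ (3 / 2 : ℝ) = ∫⁻ z, ‖q z.1 z.2‖ₑ ^ (3 / 2 : ℝ) ∂μT :=
    lintegral_Ioo_lintegral_eq_lintegral_prod (hq.enorm.pow_const _)
  rw [e3] at hv3
  rw [e32] at hq32
  have hM3 : MemLp (uncurry v) 3 μT := by
    refine ⟨hv, (eLpNorm_lt_top_iff_lintegral_rpow_enorm_lt_top three_ne_zero
      ENNReal.ofNat_ne_top).2 ?_⟩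
    have h3 : ∀ x : ℝ≥0∞, x ^ (3 : ℝ≥0∞).toReal = x ^ (3 : ℕ) := fun x => by
      rw [ENNReal.toReal_ofNat, ← ENNReal.rpow_natCast]; norm_num
    simpa only [h3, Function.uncurry] using hv3
  have I2 : Integrable (fun z => ‖v z.1 z.2‖ ^ 2) μT :=
    (memLp_two_iff_integrable_sq_norm hv).1 (hM3.mono_exponent (by norm_num))
  have I3 : Integrable (fun z => ‖v z.1 z.2‖ ^ 3) μT := by
    have h := hM3.integrable_norm_rpow three_ne_zero ENNReal.ofNat_ne_top
    refine h.congr (Eventually.of_forall fun z => ?_)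
    simp only [ENNReal.toReal_ofNat, uncurry]
    norm_cast
  have Iqv : Integrable (fun z => ‖q z.1 z.2‖ * ‖v z.1 z.2‖) μT := by
    refine ⟨(hq.norm.mul hv.norm), ?_⟩
    have hH : Real.HolderConjugate (3 / 2 : ℝ) 3 := ⟨by norm_num, by norm_num, by norm_num⟩
    have h := ENNReal.lintegral_mul_le_Lp_mul_Lq μT hH
      (f := fun z => ‖q z.1 z.2‖ₑ) (g := fun z => ‖v z.1 z.2‖ₑ) hq.enorm hv.enorm
    have h3 : ∀ x : ℝ≥0∞, x ^ (3 : ℝ) = x ^ (3 : ℕ) := fun x => by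
      rw [← ENNReal.rpow_natCast]; norm_num
    simp only [Pi.mul_apply, h3] at h
    refine lt_of_le_of_lt (lintegral_mono fun z => ?_) (lt_of_le_of_lt h ?_)
    · rw [enorm_mul, enorm_norm, enorm_norm]
    · exact ENNReal.mul_lt_top (ENNReal.rpow_lt_top_of_nonneg (by norm_num) hq32.ne)
        (ENNReal.rpow_lt_top_of_nonneg (by norm_num) hv3.ne)
  -- measurability of the integrand
  have hmeas : AEStronglyMeasurable (fun z : ℝ × UnitAddTorus d =>
      2⁻¹ * ‖v z.1 z.2‖ ^ 2 * FunctionSpaces.Torus.timeDeriv ψ z.1 z.2 +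
        (2⁻¹ * ‖v z.1 z.2‖ ^ 2 + q z.1 z.2) * ⟪v z.1 z.2, FunctionSpaces.Torus.gradient (ψ z.1) z.2⟫ +
        2⁻¹ * ν * ‖v z.1 z.2‖ ^ 2 * FunctionSpaces.Torus.laplacian (ψ z.1) z.2) μT := by
    have hv2 : AEStronglyMeasurable (fun z : ℝ × UnitAddTorus d => ‖v z.1 z.2‖ ^ 2) μT :=
      (continuous_norm.pow 2).comp_aestronglyMeasurable hv
    have hin : AEStronglyMeasurable (fun z : ℝ × UnitAddTorus d =>
        ⟪v z.1 z.2, FunctionSpaces.Torus.gradient (ψ z.1) z.2⟫) μT := hv.inner hgrm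
    exact (((aestronglyMeasurable_const.mul hv2).mul hdtm).add
      (((aestronglyMeasurable_const.mul hv2).add hq).mul hin)).add
      ((aestronglyMeasurable_const.mul hv2).mul hlam)
  -- a.e. `t ∈ (0, T)`
  have hIoo : ∀ᵐ z ∂μT, z.1 ∈ Ioo 0 T := by
    rw [hμT, ← volume_restrict_Ioo_prod_univ]
    filter_upwards [ae_restrict_mem (measurableSet_Ioo.prod MeasurableSet.univ)] with z hz
    exact hz.1
  -- domination
  set K : ℝ := Cdt + Cgr + |ν| * Cla with hK
  refine Integrable.mono' (((I2.add I3).add Iqv).const_mul K) hmeas ?_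
  filter_upwards [hIoo] with z hz
  have hzI : z.1 ∈ Icc 0 T := Ioo_subset_Icc_self hz
  set a := ‖v z.1 z.2‖ with ha
  have ha0 : 0 ≤ a := norm_nonneg _
  have h1 : |2⁻¹ * a ^ 2 * FunctionSpaces.Torus.timeDeriv ψ z.1 z.2| ≤ Cdt * a ^ 2 := by
    rw [abs_mul, abs_of_nonneg (by positivity)]
    have := hCdt z.1 hzI z.2
    rw [Real.norm_eq_abs] at this
    nlinarith [sq_nonneg a, abs_nonneg (FunctionSpaces.Torus.timeDeriv ψ z.1 z.2)]
  have h2 : |(2⁻¹ * a ^ 2 + q z.1 z.2) * ⟪v z.1 z.2, FunctionSpaces.Torus.gradient (ψ z.1) z.2⟫| ≤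
      Cgr * (a ^ 3 + ‖q z.1 z.2‖ * a) := by
    rw [abs_mul]
    have hi : |⟪v z.1 z.2, FunctionSpaces.Torus.gradient (ψ z.1) z.2⟫| ≤ a * Cgr :=
      (abs_real_inner_le_norm _ _).trans (mul_le_mul_of_nonneg_left (hCgr z.1 hzI z.2) ha0)
    have hc : |2⁻¹ * a ^ 2 + q z.1 z.2| ≤ 2⁻¹ * a ^ 2 + ‖q z.1 z.2‖ := by
      refine (abs_add_le _ _).trans ?_
      rw [abs_of_nonneg (by positivity), Real.norm_eq_abs]
    calc |2⁻¹ * a ^ 2 + q z.1 z.2| * |⟪v z.1 z.2, FunctionSpaces.Torus.gradient (ψ z.1) z.2⟫|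
        ≤ (2⁻¹ * a ^ 2 + ‖q z.1 z.2‖) * (a * Cgr) :=
          mul_le_mul hc hi (abs_nonneg _) (by positivity)
      _ ≤ Cgr * (a ^ 3 + ‖q z.1 z.2‖ * a) := by
          nlinarith [sq_nonneg a, norm_nonneg (q z.1 z.2), mul_nonneg hCgr0 (pow_nonneg ha0 3)]
  have h3 : |2⁻¹ * ν * a ^ 2 * FunctionSpaces.Torus.laplacian (ψ z.1) z.2| ≤ |ν| * Cla * a ^ 2 := by
    rw [abs_mul, abs_mul, abs_mul, abs_of_nonneg (by norm_num : (0 : ℝ) ≤ 2⁻¹),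
      abs_of_nonneg (by positivity : (0 : ℝ) ≤ a ^ 2)]
    have := hCla z.1 hzI z.2
    rw [Real.norm_eq_abs] at this
    nlinarith [sq_nonneg a, abs_nonneg ν, abs_nonneg (FunctionSpaces.Torus.laplacian (ψ z.1) z.2),
      mul_nonneg (abs_nonneg ν) (sq_nonneg a)]
  rw [Real.norm_eq_abs]
  refine (abs_add_le _ _).trans ((add_le_add ((abs_add_le _ _).trans (add_le_add h1 h2)) h3).trans ?_)
  simp only [Pi.add_apply]
  have hx1 : 0 ≤ a ^ 2 := sq_nonneg a
  have hx2 : 0 ≤ a ^ 3 := pow_nonneg ha0 3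
  have hx3 : 0 ≤ ‖q z.1 z.2‖ * a := mul_nonneg (norm_nonneg _) ha0
  have hνC : 0 ≤ |ν| * Cla := mul_nonneg (abs_nonneg ν) hCla0
  nlinarith [mul_nonneg hCdt0 hx2, mul_nonneg hCdt0 hx3, mul_nonneg hCgr0 hx1,
    mul_nonneg hνC hx2, mul_nonneg hνC hx3]

variable [DecidableEq d]

/-- **The dissipation density is integrable against test functions.** For `ν > 0` and a jointly
measurable `G` with `ν|G|² dx dt ⌊ [0,T] × T^d` a finite measure, `|G|²` is integrable on
`(0,T) × T^d`, hence so is `ν |G|² ψ` for bounded measurable `ψ`. [folklore] -/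
theorem integrable_weakGradNormSq {ν : ℝ} (hν : 0 < ν)
    {G : ℝ → UnitAddTorus d → EuclideanSpace ℝ d →L[ℝ] EuclideanSpace ℝ d}
    (hG : AEStronglyMeasurable (uncurry G) (volume.restrict (Icc 0 T ×ˢ univ)))
    (hfin : IsFiniteMeasure (dissipationMeasure ν G T)) :
    Integrable (fun z : ℝ × UnitAddTorus d => weakGradNormSq (G z.1) z.2)
      ((volume.restrict (Ioo 0 T)).prod volume) := by
  have hG' : AEStronglyMeasurable (uncurry G) ((volume.restrict (Ioo 0 T)).prod volume) := by
    rwa [volume_restrict_Icc_prod_univ] at hG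
  have hw : AEMeasurable (fun z : ℝ × UnitAddTorus d => weakGradNormSq (G z.1) z.2)
      ((volume.restrict (Ioo 0 T)).prod volume) := aemeasurable_weakGradNormSq_uncurry hG'
  refine ⟨hw.aestronglyMeasurable, ?_⟩
  have hmass := measure_lt_top (dissipationMeasure ν G T) univ
  rw [dissipationMeasure, withDensity_apply _ MeasurableSet.univ, Measure.restrict_univ,
    volume_restrict_Icc_prod_univ] at hmass
  have hsplit : ∀ z : ℝ × UnitAddTorus d, ENNReal.ofReal (ν * weakGradNormSq (G z.1) z.2) =
      ENNReal.ofReal ν * ‖weakGradNormSq (G z.1) z.2‖ₑ := fun z => by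
    rw [ENNReal.ofReal_mul hν.le, Real.enorm_eq_ofReal (weakGradNormSq_nonneg _ _)]
  simp_rw [hsplit] at hmass
  rw [lintegral_const_mul'' _ hw.enorm] at hmass
  exact ENNReal.lt_top_of_mul_ne_top_right hmass.ne ((ENNReal.ofReal_pos.2 hν).ne')

/-- **Pairing a test function with the dissipation measure** `ν|G|² dx dt ⌊ [0,T] × T^d`:
`∫ ψ d(ν|G|² dx dt) = ∫₀ᵀ∫ ν |G|² ψ` (density formula `integral_withDensity_eq_integral_toReal_smul₀`
and Fubini). [folklore] -/
theorem integral_dissipationMeasure_eq {ν : ℝ} (hν : 0 < ν)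
    {G : ℝ → UnitAddTorus d → EuclideanSpace ℝ d →L[ℝ] EuclideanSpace ℝ d}
    (hG : AEStronglyMeasurable (uncurry G) (volume.restrict (Icc 0 T ×ˢ univ)))
    (hfin : IsFiniteMeasure (dissipationMeasure ν G T))
    (hψm : AEStronglyMeasurable (uncurry ψ) ((volume.restrict (Ioo 0 T)).prod volume))
    (hψb : ∃ C : ℝ, ∀ t x, |ψ t x| ≤ C) :
    ∫ z, ψ z.1 z.2 ∂(dissipationMeasure ν G T) =
      ∫ t in Ioo 0 T, ∫ x, ν * weakGradNormSq (G t) x * ψ t x := by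
  set μT := (volume.restrict (Ioo 0 T)).prod (volume : Measure (UnitAddTorus d)) with hμT
  have hG' : AEStronglyMeasurable (uncurry G) μT := by
    rwa [volume_restrict_Icc_prod_univ] at hG
  have hw : AEMeasurable (fun z : ℝ × UnitAddTorus d => weakGradNormSq (G z.1) z.2) μT :=
    aemeasurable_weakGradNormSq_uncurry hG'
  have hdens : AEMeasurable (fun z : ℝ × UnitAddTorus d =>
      ENNReal.ofReal (ν * weakGradNormSq (G z.1) z.2)) μT := (hw.const_mul ν).ennreal_ofReal
  obtain ⟨C, hC⟩ := hψb
  have hint : Integrable (fun z : ℝ × UnitAddTorus d =>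
      ν * weakGradNormSq (G z.1) z.2 * ψ z.1 z.2) μT :=
    ((integrable_weakGradNormSq hν hG hfin).const_mul ν).mul_bdd hψm
      (Eventually.of_forall fun z => by simpa [Real.norm_eq_abs] using hC z.1 z.2)
  rw [dissipationMeasure, volume_restrict_Icc_prod_univ,
    integral_withDensity_eq_integral_toReal_smul₀ hdens
      (Eventually.of_forall fun _ => ENNReal.ofReal_lt_top),
    show (∫ t in Ioo 0 T, ∫ x, ν * weakGradNormSq (G t) x * ψ t x) =
      ∫ z, ν * weakGradNormSq (G z.1) z.2 * ψ z.1 z.2 ∂μT from (integral_prod _ hint).symm]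
  refine integral_congr_ae (Eventually.of_forall fun z => ?_)
  simp only [smul_eq_mul]
  rw [ENNReal.toReal_ofReal (mul_nonneg hν.le (weakGradNormSq_nonneg _ _))]

end Integrability

/-! ## Continuity of the local energy flux pairing (the limit passage of Prop. 4) -/

section FluxLimit

variable {F : Type*} [NormedAddCommGroup F]

-- 2026-08-14 rename (D-0022): this proof sat at the default 200 000-heartbeat edge and tipped over after the namespace
-- head swap (identical mathematics elaborated at 200k before); budget doubled, proof unchanged.
set_option maxHeartbeats 400000 in
/-- Pointwise algebra behind the continuity of the energy flux: with `e = ‖a - b‖`,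
`|½|a|²∂ₜψ + (½|a|² + p₁)⟪a,g⟫ + ½ν|a|²Δψ − ½|b|²∂ₜψ − (½|b|² + p₂)⟪b,g⟫|` is at most
`C_∂ (e² + e|b|) + C_∇ (e³ + 3e²|b| + 3e|b|²) + C_∇ (|p₁−p₂| e + |p₁−p₂||b| + |p₂| e) + |ν| C_Δ (e² + |b|²)`. [folklore] -/
theorem abs_energyFlux_sub_le {E' : Type*} [NormedAddCommGroup E'] [InnerProductSpace ℝ E']
    (a b g : E') (pm pp dt lap ν Cdt Cg Cl : ℝ)
    (hdt : |dt| ≤ Cdt) (hg : ‖g‖ ≤ Cg) (hlap : |lap| ≤ Cl) :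
    |(2⁻¹ * ‖a‖ ^ 2 * dt + (2⁻¹ * ‖a‖ ^ 2 + pm) * ⟪a, g⟫ + 2⁻¹ * ν * ‖a‖ ^ 2 * lap) -
        (2⁻¹ * ‖b‖ ^ 2 * dt + (2⁻¹ * ‖b‖ ^ 2 + pp) * ⟪b, g⟫)| ≤
      Cdt * (‖a - b‖ ^ 2 + ‖a - b‖ * ‖b‖) +
        Cg * (‖a - b‖ ^ 3 + 3 * (‖a - b‖ ^ 2 * ‖b‖) + 3 * (‖a - b‖ * ‖b‖ ^ 2)) +
        Cg * (|pm - pp| * ‖a - b‖ + |pm - pp| * ‖b‖ + |pp| * ‖a - b‖) +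
        |ν| * Cl * (‖a - b‖ ^ 2 + ‖b‖ ^ 2) := by
  set e := ‖a - b‖ with he
  set na := ‖a‖ with hna_def
  set nb := ‖b‖ with hnb_def
  have he0 : 0 ≤ e := norm_nonneg _
  have hna0 : 0 ≤ na := norm_nonneg _
  have hnb0 : 0 ≤ nb := norm_nonneg _
  have hCg0 : 0 ≤ Cg := (norm_nonneg _).trans hg
  have hCdt0 : 0 ≤ Cdt := (abs_nonneg _).trans hdt
  have hCl0 : 0 ≤ Cl := (abs_nonneg _).trans hlap
  have hna : na ≤ e + nb := by
    have := norm_le_norm_add_norm_sub' a b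
    linarith
  have hsq : |na ^ 2 - nb ^ 2| ≤ e * (na + nb) := by
    rw [sq_sub_sq, abs_mul, abs_of_nonneg (by positivity : 0 ≤ na + nb), mul_comm]
    exact mul_le_mul_of_nonneg_right (abs_norm_sub_norm_le a b) (by positivity)
  have hin : ∀ v : E', |⟪v, g⟫| ≤ ‖v‖ * Cg := fun v =>
    (abs_real_inner_le_norm v g).trans (mul_le_mul_of_nonneg_left hg (norm_nonneg _))
  have hdec : (2⁻¹ * na ^ 2 * dt + (2⁻¹ * na ^ 2 + pm) * ⟪a, g⟫ + 2⁻¹ * ν * na ^ 2 * lap) -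
        (2⁻¹ * nb ^ 2 * dt + (2⁻¹ * nb ^ 2 + pp) * ⟪b, g⟫) =
      2⁻¹ * (na ^ 2 - nb ^ 2) * dt +
        2⁻¹ * (na ^ 2 * ⟪a - b, g⟫ + (na ^ 2 - nb ^ 2) * ⟪b, g⟫) +
        ((pm - pp) * ⟪a, g⟫ + pp * ⟪a - b, g⟫) + 2⁻¹ * ν * na ^ 2 * lap := by
    rw [inner_sub_left]
    ring
  rw [hdec]
  have h1 : |2⁻¹ * (na ^ 2 - nb ^ 2) * dt| ≤ Cdt * (e ^ 2 + e * nb) := by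
    rw [abs_mul, abs_mul, abs_of_pos (by norm_num : (0 : ℝ) < 2⁻¹)]
    calc 2⁻¹ * |na ^ 2 - nb ^ 2| * |dt| ≤ 2⁻¹ * (e * (na + nb)) * Cdt := by gcongr
      _ ≤ Cdt * (e ^ 2 + e * nb) := by
          nlinarith [mul_le_mul_of_nonneg_left hna he0, mul_nonneg hCdt0 he0,
            mul_nonneg (mul_nonneg hCdt0 he0) hnb0, mul_nonneg (mul_nonneg hCdt0 he0) he0]
  have h2 : |2⁻¹ * (na ^ 2 * ⟪a - b, g⟫ + (na ^ 2 - nb ^ 2) * ⟪b, g⟫)| ≤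
      Cg * (e ^ 3 + 3 * (e ^ 2 * nb) + 3 * (e * nb ^ 2)) := by
    have h2a : |na ^ 2 * ⟪a - b, g⟫| ≤ na ^ 2 * (e * Cg) := by
      rw [abs_mul, abs_of_nonneg (sq_nonneg _)]
      exact mul_le_mul_of_nonneg_left (hin _) (sq_nonneg _)
    have h2b : |(na ^ 2 - nb ^ 2) * ⟪b, g⟫| ≤ e * (na + nb) * (nb * Cg) := by
      rw [abs_mul]
      exact mul_le_mul hsq (hin b) (abs_nonneg _) (by positivity)
    rw [abs_mul, abs_of_pos (by norm_num : (0 : ℝ) < 2⁻¹)]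
    have hna2 : na ^ 2 ≤ (e + nb) ^ 2 := pow_le_pow_left₀ hna0 hna 2
    have hk : 0 ≤ Cg * e := mul_nonneg hCg0 he0
    calc 2⁻¹ * |na ^ 2 * ⟪a - b, g⟫ + (na ^ 2 - nb ^ 2) * ⟪b, g⟫|
        ≤ 2⁻¹ * (na ^ 2 * (e * Cg) + e * (na + nb) * (nb * Cg)) := by
          gcongr
          exact (abs_add_le _ _).trans (add_le_add h2a h2b)
      _ = 2⁻¹ * (Cg * e) * (na ^ 2 + na * nb + nb ^ 2) := by ring
      _ ≤ 2⁻¹ * (Cg * e) * ((e + nb) ^ 2 + (e + nb) * nb + nb ^ 2) := by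
          gcongr 2⁻¹ * (Cg * e) * ?_
          nlinarith [mul_le_mul_of_nonneg_right hna hnb0]
      _ ≤ Cg * (e ^ 3 + 3 * (e ^ 2 * nb) + 3 * (e * nb ^ 2)) := by
          nlinarith [mul_nonneg hk (sq_nonneg e), mul_nonneg hk (mul_nonneg he0 hnb0),
            mul_nonneg hk (sq_nonneg nb)]
  have h3 : |(pm - pp) * ⟪a, g⟫ + pp * ⟪a - b, g⟫| ≤
      Cg * (|pm - pp| * e + |pm - pp| * nb + |pp| * e) := by
    have h3a : |(pm - pp) * ⟪a, g⟫| ≤ |pm - pp| * (na * Cg) := by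
      rw [abs_mul]
      exact mul_le_mul_of_nonneg_left (hin a) (abs_nonneg _)
    have h3b : |pp * ⟪a - b, g⟫| ≤ |pp| * (e * Cg) := by
      rw [abs_mul]
      exact mul_le_mul_of_nonneg_left (hin _) (abs_nonneg _)
    refine (abs_add_le _ _).trans ((add_le_add h3a h3b).trans ?_)
    have hk : 0 ≤ |pm - pp| * Cg := mul_nonneg (abs_nonneg _) hCg0
    nlinarith [mul_le_mul_of_nonneg_left hna hk]
  have h4 : |2⁻¹ * ν * na ^ 2 * lap| ≤ |ν| * Cl * (e ^ 2 + nb ^ 2) := by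
    rw [abs_mul, abs_mul, abs_mul, abs_of_pos (by norm_num : (0 : ℝ) < 2⁻¹),
      abs_of_nonneg (sq_nonneg na)]
    have hna2 : na ^ 2 ≤ (e + nb) ^ 2 := pow_le_pow_left₀ hna0 hna 2
    have hk : 0 ≤ |ν| * Cl := mul_nonneg (abs_nonneg _) hCl0
    calc 2⁻¹ * |ν| * na ^ 2 * |lap| ≤ 2⁻¹ * |ν| * na ^ 2 * Cl := by gcongr
      _ = 2⁻¹ * (|ν| * Cl) * na ^ 2 := by ring
      _ ≤ 2⁻¹ * (|ν| * Cl) * (e + nb) ^ 2 := by gcongr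
      _ ≤ |ν| * Cl * (e ^ 2 + nb ^ 2) := by
          nlinarith [mul_nonneg hk (sq_nonneg (e - nb))]
  calc |2⁻¹ * (na ^ 2 - nb ^ 2) * dt +
          2⁻¹ * (na ^ 2 * ⟪a - b, g⟫ + (na ^ 2 - nb ^ 2) * ⟪b, g⟫) +
          ((pm - pp) * ⟪a, g⟫ + pp * ⟪a - b, g⟫) + 2⁻¹ * ν * na ^ 2 * lap|
      ≤ |2⁻¹ * (na ^ 2 - nb ^ 2) * dt| +
          |2⁻¹ * (na ^ 2 * ⟪a - b, g⟫ + (na ^ 2 - nb ^ 2) * ⟪b, g⟫)| +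
          |(pm - pp) * ⟪a, g⟫ + pp * ⟪a - b, g⟫| + |2⁻¹ * ν * na ^ 2 * lap| := by
        refine (abs_add_le _ _).trans (add_le_add ((abs_add_le _ _).trans
          (add_le_add (abs_add_le _ _) le_rfl)) le_rfl)
    _ ≤ _ := by linarith [h1, h2, h3, h4]

/-- Hölder with exponents `3/2` and `3` for lower integrals of `ℝ≥0∞`-valued functions:
`∫⁻ f g ≤ (∫⁻ f^{3/2})^{2/3} (∫⁻ g³)^{1/3}`. [folklore] -/
theorem lintegral_mul_le_L32_mul_L3 {α : Type*} [MeasurableSpace α] (μ : Measure α)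
    {f g : α → ℝ≥0∞} (hf : AEMeasurable f μ) (hg : AEMeasurable g μ) :
    ∫⁻ a, f a * g a ∂μ ≤ (∫⁻ a, f a ^ (3 / 2 : ℝ) ∂μ) ^ (2 / 3 : ℝ) *
      (∫⁻ a, g a ^ (3 : ℝ) ∂μ) ^ (1 / 3 : ℝ) := by
  have hH : Real.HolderConjugate (3 / 2 : ℝ) 3 := ⟨by norm_num, by norm_num, by norm_num⟩
  have h := ENNReal.lintegral_mul_le_Lp_mul_Lq μ hH hf hg
  simp only [Pi.mul_apply] at h
  convert h using 3
  norm_num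

/-- `(x²)^{3/2} = x³` in `ℝ≥0∞`. [folklore] -/
theorem ENNReal.sq_rpow_three_halves (x : ℝ≥0∞) : (x ^ 2) ^ (3 / 2 : ℝ) = x ^ (3 : ℝ) := by
  rw [← ENNReal.rpow_natCast x 2, ← ENNReal.rpow_mul]
  norm_num

/-- `u_m → u` in `L^{r}_{t,x}` (`1 ≤ r`) and `u ∈ L^r_{t,x}` give `u_m ∈ L^r_{t,x}` eventually. [folklore] -/
theorem eventually_lintegral_enorm_rpow_lt_top {r : ℝ} (hr : 1 ≤ r) {useq : ℕ → ℝ → UnitAddTorus d → F}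
    {v : ℝ → UnitAddTorus d → F}
    (hmeas_seq : ∀ᶠ m in atTop,
      AEStronglyMeasurable (uncurry (useq m)) ((volume.restrict (Ioo 0 T)).prod volume))
    (hmeas : AEStronglyMeasurable (uncurry v) ((volume.restrict (Ioo 0 T)).prod volume))
    (hconv : Tendsto (fun m => ∫⁻ t in Ioo 0 T, ∫⁻ x, ‖useq m t x - v t x‖ₑ ^ r) atTop (𝓝 0))
    (hv : ∫⁻ t in Ioo 0 T, ∫⁻ x, ‖v t x‖ₑ ^ r < ∞) :
    ∀ᶠ m in atTop, ∫⁻ t in Ioo 0 T, ∫⁻ x, ‖useq m t x‖ₑ ^ r < ∞ := by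
  set μT := (volume.restrict (Ioo 0 T)).prod (volume : Measure (UnitAddTorus d)) with hμT
  have hr0 : 0 ≤ r := zero_le_one.trans hr
  have hfin : ∀ᶠ m in atTop, ∫⁻ t in Ioo 0 T, ∫⁻ x, ‖useq m t x - v t x‖ₑ ^ r < ∞ :=
    hconv.eventually (eventually_lt_nhds ENNReal.zero_lt_top)
  filter_upwards [hmeas_seq, hfin] with m hm hfm
  have hdiff : AEStronglyMeasurable (fun z : ℝ × UnitAddTorus d => useq m z.1 z.2 - v z.1 z.2) μT :=
    hm.sub hmeas
  have e1 : ∫⁻ t in Ioo 0 T, ∫⁻ x, ‖useq m t x‖ₑ ^ r = ∫⁻ z, ‖useq m z.1 z.2‖ₑ ^ r ∂μT :=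
    lintegral_Ioo_lintegral_eq_lintegral_prod (hm.enorm.pow_const _)
  have e2 : ∫⁻ t in Ioo 0 T, ∫⁻ x, ‖useq m t x - v t x‖ₑ ^ r =
      ∫⁻ z, ‖useq m z.1 z.2 - v z.1 z.2‖ₑ ^ r ∂μT :=
    lintegral_Ioo_lintegral_eq_lintegral_prod (hdiff.enorm.pow_const _)
  have e3 : ∫⁻ t in Ioo 0 T, ∫⁻ x, ‖v t x‖ₑ ^ r = ∫⁻ z, ‖v z.1 z.2‖ₑ ^ r ∂μT :=
    lintegral_Ioo_lintegral_eq_lintegral_prod (hmeas.enorm.pow_const _)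
  rw [e1]
  rw [e2] at hfm
  rw [e3] at hv
  have hpt : ∀ z : ℝ × UnitAddTorus d, ‖useq m z.1 z.2‖ₑ ^ r ≤
      2 ^ (r - 1) * (‖useq m z.1 z.2 - v z.1 z.2‖ₑ ^ r + ‖v z.1 z.2‖ₑ ^ r) := by
    intro z
    have htri : ‖useq m z.1 z.2‖ₑ ≤ ‖useq m z.1 z.2 - v z.1 z.2‖ₑ + ‖v z.1 z.2‖ₑ := by
      calc ‖useq m z.1 z.2‖ₑ = ‖(useq m z.1 z.2 - v z.1 z.2) + v z.1 z.2‖ₑ := by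
            rw [sub_add_cancel]
        _ ≤ _ := enorm_add_le _ _
    exact (ENNReal.rpow_le_rpow htri hr0).trans (ENNReal.rpow_add_le_mul_rpow_add_rpow _ _ hr)
  have h2 : (2 : ℝ≥0∞) ^ (r - 1) ≠ ∞ := ENNReal.rpow_ne_top_of_nonneg (by linarith) ENNReal.ofNat_ne_top
  calc ∫⁻ z, ‖useq m z.1 z.2‖ₑ ^ r ∂μT
      ≤ ∫⁻ z, 2 ^ (r - 1) * (‖useq m z.1 z.2 - v z.1 z.2‖ₑ ^ r + ‖v z.1 z.2‖ₑ ^ r) ∂μT :=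
        lintegral_mono hpt
    _ = 2 ^ (r - 1) * ((∫⁻ z, ‖useq m z.1 z.2 - v z.1 z.2‖ₑ ^ r ∂μT) +
          ∫⁻ z, ‖v z.1 z.2‖ₑ ^ r ∂μT) := by
        rw [lintegral_const_mul' _ _ h2, lintegral_add_left' (hdiff.enorm.pow_const _)]
    _ < ∞ := ENNReal.mul_lt_top h2.lt_top (ENNReal.add_lt_top.2 ⟨hfm, hv⟩)

/-- On the finite measure space `(0,T) × T^d`, `∫∫ ‖f‖^{3/2} < ∞` for `f ∈ L³`. [folklore] -/
theorem lintegral_enorm_rpow_three_halves_lt_top {f : ℝ × UnitAddTorus d → F}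
    (hf : AEStronglyMeasurable f ((volume.restrict (Ioo 0 T)).prod volume))
    (h3 : ∫⁻ z, ‖f z‖ₑ ^ (3 : ℝ) ∂((volume.restrict (Ioo 0 T)).prod volume) < ∞) :
    ∫⁻ z, ‖f z‖ₑ ^ (3 / 2 : ℝ) ∂((volume.restrict (Ioo 0 T)).prod volume) < ∞ := by
  have hM3 : MemLp f 3 ((volume.restrict (Ioo 0 T)).prod volume) := by
    refine ⟨hf, (eLpNorm_lt_top_iff_lintegral_rpow_enorm_lt_top three_ne_zero
      ENNReal.ofNat_ne_top).2 ?_⟩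
    simpa only [ENNReal.toReal_ofNat] using h3
  have hM : MemLp f (3 / 2) ((volume.restrict (Ioo 0 T)).prod volume) :=
    hM3.mono_exponent (ENNReal.div_le_of_le_mul (by norm_num))
  have h := (eLpNorm_lt_top_iff_lintegral_rpow_enorm_lt_top (p := (3 / 2 : ℝ≥0∞)) (by norm_num)
    (ENNReal.div_ne_top ENNReal.ofNat_ne_top (by norm_num))).1 hM.2
  have h32 : ((3 / 2 : ℝ≥0∞)).toReal = (3 / 2 : ℝ) := by
    rw [ENNReal.toReal_div, ENNReal.toReal_ofNat, ENNReal.toReal_ofNat]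
  simpa only [h32] using h


/-- Pointwise bound of `abs_energyFlux_sub_le`, cast to `ℝ≥0∞`. [folklore] -/
theorem enorm_energyFlux_sub_le {E' : Type*} [NormedAddCommGroup E'] [InnerProductSpace ℝ E']
    (a b g : E') (pm pp dt lap ν Cdt Cg Cl : ℝ)
    (hdt : |dt| ≤ Cdt) (hg : ‖g‖ ≤ Cg) (hlap : |lap| ≤ Cl) :
    ‖(2⁻¹ * ‖a‖ ^ 2 * dt + (2⁻¹ * ‖a‖ ^ 2 + pm) * ⟪a, g⟫ + 2⁻¹ * ν * ‖a‖ ^ 2 * lap) -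
        (2⁻¹ * ‖b‖ ^ 2 * dt + (2⁻¹ * ‖b‖ ^ 2 + pp) * ⟪b, g⟫)‖ₑ ≤
      ENNReal.ofReal Cdt * (‖a - b‖ₑ ^ 2 + ‖b‖ₑ * ‖a - b‖ₑ) +
        ENNReal.ofReal Cg * (‖a - b‖ₑ ^ 3 + 3 * (‖a - b‖ₑ ^ 2 * ‖b‖ₑ) + 3 * (‖b‖ₑ ^ 2 * ‖a - b‖ₑ)) +
        ENNReal.ofReal Cg * (‖pm - pp‖ₑ * ‖a - b‖ₑ + ‖pm - pp‖ₑ * ‖b‖ₑ + ‖pp‖ₑ * ‖a - b‖ₑ) +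
        ‖ν‖ₑ * ENNReal.ofReal Cl * (‖a - b‖ₑ ^ 2 + ‖b‖ₑ ^ 2) := by
  have hCg0 : 0 ≤ Cg := (norm_nonneg _).trans hg
  have hCdt0 : 0 ≤ Cdt := (abs_nonneg _).trans hdt
  have hCl0 : 0 ≤ Cl := (abs_nonneg _).trans hlap
  have hreal := abs_energyFlux_sub_le a b g pm pp dt lap ν Cdt Cg Cl hdt hg hlap
  rw [Real.enorm_eq_ofReal_abs]
  refine (ENNReal.ofReal_le_ofReal hreal).trans (le_of_eq ?_)
  rw [mul_comm ‖a - b‖ ‖b‖, mul_comm ‖a - b‖ (‖b‖ ^ 2)]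
  simp (disch := positivity) only [ENNReal.ofReal_add, ENNReal.ofReal_mul, ENNReal.ofReal_pow,
    ENNReal.ofReal_ofNat, ofReal_norm, ← Real.enorm_eq_ofReal_abs]

/-- The explicit majorant of the `L¹` distance of energy fluxes furnished by Hölder's inequality
(`lintegral_enorm_energyFlux_sub_le`): here `A = ∫∫|u_m-u|³`, `B = (∫∫|p_m-p|^{3/2})^{2/3}`,
`U = ∫∫|u|³`, `P = (∫∫|p|^{3/2})^{2/3}`, `N = (∫∫|u|^{3/2})^{2/3}`, `M = (T·1)^{1/3}`, `n = |ν_m|`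
and `c₁, c₂, c₃` bound `∂ₜψ`, `∇ψ`, `Δψ`. [folklore] -/
def fluxBound (c₁ c₂ c₃ n A B U P N M : ℝ≥0∞) : ℝ≥0∞ :=
  c₁ * (A ^ (2 / 3 : ℝ) * M + N * A ^ (1 / 3 : ℝ)) +
    c₂ * (A + 3 * (A ^ (2 / 3 : ℝ) * U ^ (1 / 3 : ℝ)) + 3 * (U ^ (2 / 3 : ℝ) * A ^ (1 / 3 : ℝ))) +
    c₂ * (B * A ^ (1 / 3 : ℝ) + B * U ^ (1 / 3 : ℝ) + P * A ^ (1 / 3 : ℝ)) +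
    n * c₃ * (A ^ (2 / 3 : ℝ) * M + U ^ (2 / 3 : ℝ) * M)

/-- **The `L¹` distance of energy fluxes is controlled by `fluxBound`** (pointwise algebra
`enorm_energyFlux_sub_le`, then Hölder `3/2, 3` monomial by monomial). [folklore] -/
theorem lintegral_enorm_energyFlux_sub_le {α : Type*} [MeasurableSpace α] (μ : Measure α)
    {E' : Type*} [NormedAddCommGroup E'] [InnerProductSpace ℝ E']
    {a b g : α → E'} {qa qb dt lap : α → ℝ} (ν : ℝ) {Cdt Cg Cl : ℝ}
    (hdt : ∀ᵐ x ∂μ, |dt x| ≤ Cdt) (hg : ∀ᵐ x ∂μ, ‖g x‖ ≤ Cg) (hlap : ∀ᵐ x ∂μ, |lap x| ≤ Cl)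
    (ma : AEMeasurable (fun x => ‖a x - b x‖ₑ) μ) (mb : AEMeasurable (fun x => ‖b x‖ₑ) μ)
    (mq : AEMeasurable (fun x => ‖qa x - qb x‖ₑ) μ) (mp : AEMeasurable (fun x => ‖qb x‖ₑ) μ) :
    ∫⁻ x, ‖(2⁻¹ * ‖a x‖ ^ 2 * dt x + (2⁻¹ * ‖a x‖ ^ 2 + qa x) * ⟪a x, g x⟫ +
        2⁻¹ * ν * ‖a x‖ ^ 2 * lap x) -
        (2⁻¹ * ‖b x‖ ^ 2 * dt x + (2⁻¹ * ‖b x‖ ^ 2 + qb x) * ⟪b x, g x⟫)‖ₑ ∂μ ≤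
      fluxBound (ENNReal.ofReal Cdt) (ENNReal.ofReal Cg) (ENNReal.ofReal Cl) ‖ν‖ₑ
        (∫⁻ x, ‖a x - b x‖ₑ ^ (3 : ℝ) ∂μ)
        ((∫⁻ x, ‖qa x - qb x‖ₑ ^ (3 / 2 : ℝ) ∂μ) ^ (2 / 3 : ℝ))
        (∫⁻ x, ‖b x‖ₑ ^ (3 : ℝ) ∂μ)
        ((∫⁻ x, ‖qb x‖ₑ ^ (3 / 2 : ℝ) ∂μ) ^ (2 / 3 : ℝ))
        ((∫⁻ x, ‖b x‖ₑ ^ (3 / 2 : ℝ) ∂μ) ^ (2 / 3 : ℝ))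
        ((μ univ) ^ (1 / 3 : ℝ)) := by
  -- pointwise
  have hpt : ∀ᵐ x ∂μ, ‖(2⁻¹ * ‖a x‖ ^ 2 * dt x + (2⁻¹ * ‖a x‖ ^ 2 + qa x) * ⟪a x, g x⟫ +
        2⁻¹ * ν * ‖a x‖ ^ 2 * lap x) -
        (2⁻¹ * ‖b x‖ ^ 2 * dt x + (2⁻¹ * ‖b x‖ ^ 2 + qb x) * ⟪b x, g x⟫)‖ₑ ≤
      ENNReal.ofReal Cdt * (‖a x - b x‖ₑ ^ 2 + ‖b x‖ₑ * ‖a x - b x‖ₑ) +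
        ENNReal.ofReal Cg * (‖a x - b x‖ₑ ^ 3 + 3 * (‖a x - b x‖ₑ ^ 2 * ‖b x‖ₑ) +
          3 * (‖b x‖ₑ ^ 2 * ‖a x - b x‖ₑ)) +
        ENNReal.ofReal Cg * (‖qa x - qb x‖ₑ * ‖a x - b x‖ₑ + ‖qa x - qb x‖ₑ * ‖b x‖ₑ +
          ‖qb x‖ₑ * ‖a x - b x‖ₑ) +
        ‖ν‖ₑ * ENNReal.ofReal Cl * (‖a x - b x‖ₑ ^ 2 + ‖b x‖ₑ ^ 2) := by
    filter_upwards [hdt, hg, hlap] with x h1 h2 h3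
    exact enorm_energyFlux_sub_le (a x) (b x) (g x) (qa x) (qb x) (dt x) (lap x) ν Cdt Cg Cl h1 h2 h3
  refine (lintegral_mono_ae hpt).trans ?_
  -- Hölder for the monomials
  have sq32 : ∀ y : ℝ≥0∞, (y ^ 2) ^ (3 / 2 : ℝ) = y ^ (3 : ℝ) := ENNReal.sq_rpow_three_halves
  have M1 : ∫⁻ x, ‖a x - b x‖ₑ ^ 2 ∂μ ≤
      (∫⁻ x, ‖a x - b x‖ₑ ^ (3 : ℝ) ∂μ) ^ (2 / 3 : ℝ) * (μ univ) ^ (1 / 3 : ℝ) := by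
    have h := lintegral_mul_le_L32_mul_L3 μ (ma.pow_const 2) aemeasurable_const (g := fun _ => 1)
    simp only [mul_one, ENNReal.one_rpow, lintegral_const, one_mul, sq32] at h
    exact h
  have M2 : ∫⁻ x, ‖b x‖ₑ * ‖a x - b x‖ₑ ∂μ ≤
      (∫⁻ x, ‖b x‖ₑ ^ (3 / 2 : ℝ) ∂μ) ^ (2 / 3 : ℝ) * (∫⁻ x, ‖a x - b x‖ₑ ^ (3 : ℝ) ∂μ) ^ (1 / 3 : ℝ) :=
    lintegral_mul_le_L32_mul_L3 μ mb ma
  have M3 : ∫⁻ x, ‖a x - b x‖ₑ ^ 3 ∂μ = ∫⁻ x, ‖a x - b x‖ₑ ^ (3 : ℝ) ∂μ := by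
    simp only [ENNReal.rpow_ofNat]
  have M4 : ∫⁻ x, ‖a x - b x‖ₑ ^ 2 * ‖b x‖ₑ ∂μ ≤
      (∫⁻ x, ‖a x - b x‖ₑ ^ (3 : ℝ) ∂μ) ^ (2 / 3 : ℝ) * (∫⁻ x, ‖b x‖ₑ ^ (3 : ℝ) ∂μ) ^ (1 / 3 : ℝ) := by
    have h := lintegral_mul_le_L32_mul_L3 μ (ma.pow_const 2) mb
    simp only [sq32] at h
    exact h
  have M5 : ∫⁻ x, ‖b x‖ₑ ^ 2 * ‖a x - b x‖ₑ ∂μ ≤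
      (∫⁻ x, ‖b x‖ₑ ^ (3 : ℝ) ∂μ) ^ (2 / 3 : ℝ) * (∫⁻ x, ‖a x - b x‖ₑ ^ (3 : ℝ) ∂μ) ^ (1 / 3 : ℝ) := by
    have h := lintegral_mul_le_L32_mul_L3 μ (mb.pow_const 2) ma
    simp only [sq32] at h
    exact h
  have M6 : ∫⁻ x, ‖qa x - qb x‖ₑ * ‖a x - b x‖ₑ ∂μ ≤
      (∫⁻ x, ‖qa x - qb x‖ₑ ^ (3 / 2 : ℝ) ∂μ) ^ (2 / 3 : ℝ) *
        (∫⁻ x, ‖a x - b x‖ₑ ^ (3 : ℝ) ∂μ) ^ (1 / 3 : ℝ) :=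
    lintegral_mul_le_L32_mul_L3 μ mq ma
  have M7 : ∫⁻ x, ‖qa x - qb x‖ₑ * ‖b x‖ₑ ∂μ ≤
      (∫⁻ x, ‖qa x - qb x‖ₑ ^ (3 / 2 : ℝ) ∂μ) ^ (2 / 3 : ℝ) * (∫⁻ x, ‖b x‖ₑ ^ (3 : ℝ) ∂μ) ^ (1 / 3 : ℝ) :=
    lintegral_mul_le_L32_mul_L3 μ mq mb
  have M8 : ∫⁻ x, ‖qb x‖ₑ * ‖a x - b x‖ₑ ∂μ ≤
      (∫⁻ x, ‖qb x‖ₑ ^ (3 / 2 : ℝ) ∂μ) ^ (2 / 3 : ℝ) * (∫⁻ x, ‖a x - b x‖ₑ ^ (3 : ℝ) ∂μ) ^ (1 / 3 : ℝ) :=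
    lintegral_mul_le_L32_mul_L3 μ mp ma
  have M9 : ∫⁻ x, ‖b x‖ₑ ^ 2 ∂μ ≤
      (∫⁻ x, ‖b x‖ₑ ^ (3 : ℝ) ∂μ) ^ (2 / 3 : ℝ) * (μ univ) ^ (1 / 3 : ℝ) := by
    have h := lintegral_mul_le_L32_mul_L3 μ (mb.pow_const 2) aemeasurable_const (g := fun _ => 1)
    simp only [mul_one, ENNReal.one_rpow, lintegral_const, one_mul, sq32] at h
    exact h
  -- linearity of the lower integral
  have hc1 : ENNReal.ofReal Cdt ≠ ∞ := ENNReal.ofReal_ne_top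
  have hc2 : ENNReal.ofReal Cg ≠ ∞ := ENNReal.ofReal_ne_top
  have hc4 : ‖ν‖ₑ * ENNReal.ofReal Cl ≠ ∞ := ENNReal.mul_ne_top enorm_ne_top ENNReal.ofReal_ne_top
  have m1 : AEMeasurable (fun x => ‖a x - b x‖ₑ ^ 2) μ := ma.pow_const 2
  have m2 : AEMeasurable (fun x => ‖b x‖ₑ * ‖a x - b x‖ₑ) μ := mb.mul ma
  have m3 : AEMeasurable (fun x => ‖a x - b x‖ₑ ^ 3) μ := ma.pow_const 3
  have m4 : AEMeasurable (fun x => 3 * (‖a x - b x‖ₑ ^ 2 * ‖b x‖ₑ)) μ := (m1.mul mb).const_mul _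
  have m5 : AEMeasurable (fun x => 3 * (‖b x‖ₑ ^ 2 * ‖a x - b x‖ₑ)) μ :=
    ((mb.pow_const 2).mul ma).const_mul _
  have m6 : AEMeasurable (fun x => ‖qa x - qb x‖ₑ * ‖a x - b x‖ₑ) μ := mq.mul ma
  have m7 : AEMeasurable (fun x => ‖qa x - qb x‖ₑ * ‖b x‖ₑ) μ := mq.mul mb
  have m8 : AEMeasurable (fun x => ‖qb x‖ₑ * ‖a x - b x‖ₑ) μ := mp.mul ma
  have m9 : AEMeasurable (fun x => ‖b x‖ₑ ^ 2) μ := mb.pow_const 2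
  have m12 : AEMeasurable (fun x => ‖a x - b x‖ₑ ^ 2 + ‖b x‖ₑ * ‖a x - b x‖ₑ) μ := m1.add m2
  have m34 : AEMeasurable (fun x => ‖a x - b x‖ₑ ^ 3 + 3 * (‖a x - b x‖ₑ ^ 2 * ‖b x‖ₑ)) μ :=
    m3.add m4
  have m345 : AEMeasurable (fun x => ‖a x - b x‖ₑ ^ 3 + 3 * (‖a x - b x‖ₑ ^ 2 * ‖b x‖ₑ) +
      3 * (‖b x‖ₑ ^ 2 * ‖a x - b x‖ₑ)) μ := m34.add m5
  have m67 : AEMeasurable (fun x => ‖qa x - qb x‖ₑ * ‖a x - b x‖ₑ + ‖qa x - qb x‖ₑ * ‖b x‖ₑ) μ :=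
    m6.add m7
  have m678 : AEMeasurable (fun x => ‖qa x - qb x‖ₑ * ‖a x - b x‖ₑ + ‖qa x - qb x‖ₑ * ‖b x‖ₑ +
      ‖qb x‖ₑ * ‖a x - b x‖ₑ) μ := m67.add m8
  have s1 : AEMeasurable (fun x => ENNReal.ofReal Cdt * (‖a x - b x‖ₑ ^ 2 + ‖b x‖ₑ * ‖a x - b x‖ₑ)) μ :=
    m12.const_mul _
  have s2 : AEMeasurable (fun x => ENNReal.ofReal Cg * (‖a x - b x‖ₑ ^ 3 +
      3 * (‖a x - b x‖ₑ ^ 2 * ‖b x‖ₑ) + 3 * (‖b x‖ₑ ^ 2 * ‖a x - b x‖ₑ))) μ :=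
    m345.const_mul _
  have s3 : AEMeasurable (fun x => ENNReal.ofReal Cg * (‖qa x - qb x‖ₑ * ‖a x - b x‖ₑ +
      ‖qa x - qb x‖ₑ * ‖b x‖ₑ + ‖qb x‖ₑ * ‖a x - b x‖ₑ)) μ :=
    m678.const_mul _
  have s12 : AEMeasurable (fun x => ENNReal.ofReal Cdt * (‖a x - b x‖ₑ ^ 2 + ‖b x‖ₑ * ‖a x - b x‖ₑ) +
      ENNReal.ofReal Cg * (‖a x - b x‖ₑ ^ 3 +
      3 * (‖a x - b x‖ₑ ^ 2 * ‖b x‖ₑ) + 3 * (‖b x‖ₑ ^ 2 * ‖a x - b x‖ₑ))) μ := s1.add s2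
  have s123 : AEMeasurable (fun x => ENNReal.ofReal Cdt * (‖a x - b x‖ₑ ^ 2 + ‖b x‖ₑ * ‖a x - b x‖ₑ) +
      ENNReal.ofReal Cg * (‖a x - b x‖ₑ ^ 3 +
      3 * (‖a x - b x‖ₑ ^ 2 * ‖b x‖ₑ) + 3 * (‖b x‖ₑ ^ 2 * ‖a x - b x‖ₑ)) +
      ENNReal.ofReal Cg * (‖qa x - qb x‖ₑ * ‖a x - b x‖ₑ +
      ‖qa x - qb x‖ₑ * ‖b x‖ₑ + ‖qb x‖ₑ * ‖a x - b x‖ₑ)) μ := s12.add s3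
  rw [lintegral_add_left' s123, lintegral_add_left' s12, lintegral_add_left' s1]
  rw [lintegral_const_mul' _ _ hc1, lintegral_const_mul' _ _ hc2, lintegral_const_mul' _ _ hc2,
    lintegral_const_mul' _ _ hc4]
  rw [lintegral_add_left' m1, lintegral_add_left' m34, lintegral_add_left' m3,
    lintegral_add_left' m67, lintegral_add_left' m6, lintegral_add_left' m1]
  rw [lintegral_const_mul' _ _ ENNReal.ofNat_ne_top, lintegral_const_mul' _ _ ENNReal.ofNat_ne_top,
    M3]
  unfold fluxBound
  exact add_le_add (add_le_add (add_le_add (mul_le_mul' le_rfl (add_le_add M1 M2))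
    (mul_le_mul' le_rfl (add_le_add (add_le_add le_rfl (mul_le_mul' le_rfl M4))
      (mul_le_mul' le_rfl M5))))
    (mul_le_mul' le_rfl (add_le_add (add_le_add M6 M7) M8)))
    (mul_le_mul' le_rfl (add_le_add M1 M9))

/-- `fluxBound → 0` along `A_m → 0`, `B_m → 0`, `n_m → 0` when the fixed quantities are
finite. [folklore] -/
theorem tendsto_fluxBound {c₁ c₂ c₃ U P N M : ℝ≥0∞} (hc₁ : c₁ ≠ ∞) (hc₂ : c₂ ≠ ∞) (hc₃ : c₃ ≠ ∞)
    (hU : U ≠ ∞) (hP : P ≠ ∞) (hN : N ≠ ∞) (hM : M ≠ ∞)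
    {A B n : ℕ → ℝ≥0∞} (hA : Tendsto A atTop (𝓝 0)) (hB : Tendsto B atTop (𝓝 0))
    (hn : Tendsto n atTop (𝓝 0)) :
    Tendsto (fun m => fluxBound c₁ c₂ c₃ (n m) (A m) (B m) U P N M) atTop (𝓝 0) := by
  have hA13 : Tendsto (fun m => A m ^ (1 / 3 : ℝ)) atTop (𝓝 0) := by
    have := ((ENNReal.continuous_rpow_const (y := (1 / 3 : ℝ))).tendsto 0).comp hA
    rwa [ENNReal.zero_rpow_of_pos (by norm_num)] at this
  have hA23 : Tendsto (fun m => A m ^ (2 / 3 : ℝ)) atTop (𝓝 0) := by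
    have := ((ENNReal.continuous_rpow_const (y := (2 / 3 : ℝ))).tendsto 0).comp hA
    rwa [ENNReal.zero_rpow_of_pos (by norm_num)] at this
  have hU13 : U ^ (1 / 3 : ℝ) ≠ ∞ := ENNReal.rpow_ne_top_of_nonneg (by norm_num) hU
  have hU23 : U ^ (2 / 3 : ℝ) ≠ ∞ := ENNReal.rpow_ne_top_of_nonneg (by norm_num) hU
  have t1 : Tendsto (fun m => A m ^ (2 / 3 : ℝ) * M) atTop (𝓝 0) := by
    simpa using ENNReal.Tendsto.mul_const hA23 (Or.inr hM)
  have t2 : Tendsto (fun m => N * A m ^ (1 / 3 : ℝ)) atTop (𝓝 0) := by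
    simpa using ENNReal.Tendsto.const_mul hA13 (Or.inr hN)
  have t4 : Tendsto (fun m => 3 * (A m ^ (2 / 3 : ℝ) * U ^ (1 / 3 : ℝ))) atTop (𝓝 0) := by
    have h : Tendsto (fun m => A m ^ (2 / 3 : ℝ) * U ^ (1 / 3 : ℝ)) atTop (𝓝 0) := by
      simpa using ENNReal.Tendsto.mul_const hA23 (Or.inr hU13)
    simpa using ENNReal.Tendsto.const_mul h (Or.inr ENNReal.ofNat_ne_top)
  have t5 : Tendsto (fun m => 3 * (U ^ (2 / 3 : ℝ) * A m ^ (1 / 3 : ℝ))) atTop (𝓝 0) := by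
    have h : Tendsto (fun m => U ^ (2 / 3 : ℝ) * A m ^ (1 / 3 : ℝ)) atTop (𝓝 0) := by
      simpa using ENNReal.Tendsto.const_mul hA13 (Or.inr hU23)
    simpa using ENNReal.Tendsto.const_mul h (Or.inr ENNReal.ofNat_ne_top)
  have t6 : Tendsto (fun m => B m * A m ^ (1 / 3 : ℝ)) atTop (𝓝 0) := by
    simpa using ENNReal.Tendsto.mul hB (Or.inr ENNReal.zero_ne_top) hA13 (Or.inr ENNReal.zero_ne_top)
  have t7 : Tendsto (fun m => B m * U ^ (1 / 3 : ℝ)) atTop (𝓝 0) := by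
    simpa using ENNReal.Tendsto.mul_const hB (Or.inr hU13)
  have t8 : Tendsto (fun m => P * A m ^ (1 / 3 : ℝ)) atTop (𝓝 0) := by
    simpa using ENNReal.Tendsto.const_mul hA13 (Or.inr hP)
  have t9 : Tendsto (fun m => A m ^ (2 / 3 : ℝ) * M + U ^ (2 / 3 : ℝ) * M) atTop
      (𝓝 (0 + U ^ (2 / 3 : ℝ) * M)) := t1.add tendsto_const_nhds
  have t10 : Tendsto (fun m => n m * c₃ * (A m ^ (2 / 3 : ℝ) * M + U ^ (2 / 3 : ℝ) * M)) atTop (𝓝 0) := by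
    have hn' : Tendsto (fun m => n m * c₃) atTop (𝓝 0) := by
      simpa using ENNReal.Tendsto.mul_const hn (Or.inr hc₃)
    have h := ENNReal.Tendsto.mul hn' (Or.inr (by
      rw [zero_add]; exact ENNReal.mul_ne_top hU23 hM)) t9 (Or.inr ENNReal.zero_ne_top)
    simpa using h
  have g1 : Tendsto (fun m => c₁ * (A m ^ (2 / 3 : ℝ) * M + N * A m ^ (1 / 3 : ℝ))) atTop (𝓝 0) := by
    simpa using ENNReal.Tendsto.const_mul (t1.add t2) (Or.inr hc₁)
  have g2 : Tendsto (fun m => c₂ * (A m + 3 * (A m ^ (2 / 3 : ℝ) * U ^ (1 / 3 : ℝ)) +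
      3 * (U ^ (2 / 3 : ℝ) * A m ^ (1 / 3 : ℝ)))) atTop (𝓝 0) := by
    simpa using ENNReal.Tendsto.const_mul ((hA.add t4).add t5) (Or.inr hc₂)
  have g3 : Tendsto (fun m => c₂ * (B m * A m ^ (1 / 3 : ℝ) + B m * U ^ (1 / 3 : ℝ) +
      P * A m ^ (1 / 3 : ℝ))) atTop (𝓝 0) := by
    simpa using ENNReal.Tendsto.const_mul ((t6.add t7).add t8) (Or.inr hc₂)
  simpa [fluxBound] using ((g1.add g2).add g3).add t10

/-- **Continuity of the local energy flux pairing** (the limit passage in the proof of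
Duchon–Robert 2000, Prop. 4; Drivas–Eyink 2019, proof of Thm. 2(ii), p. 11: the pointwise
bounds `|J⁰| ≲ ‖u‖₃³ + ‖p‖_{3/2}‖u‖₃`, `½|u|² ≲ ‖u‖₂²` and dominated convergence). If `u_m → u`
in `L³((0,T) × T^d)`, `p_m → p` in `L^{3/2}((0,T) × T^d)` (all jointly measurable, `u ∈ L³`,
`p ∈ L^{3/2}`) and `ν_m → 0`, then for every test function `ψ` supported in `(0, T)`
`∫₀ᵀ∫ [½|u_m|²∂ₜψ + (½|u_m|² + p_m)⟪u_m, ∇ψ⟫ + ½ν_m|u_m|²Δψ] → ∫₀ᵀ∫ [½|u|²∂ₜψ + (½|u|² + p)⟪u, ∇ψ⟫]`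
(the cubic term by Hölder `3, 3, 3`, the pressure term by Hölder `3/2, 3`, the viscous term is
`O(ν_m ‖u_m‖₂²)`). The integrands are those of `Torus.HasLocalEnergyBalance`. Proof: the pointwise algebra `abs_energyFlux_sub_le`, Hölder term by term
(`lintegral_enorm_energyFlux_sub_le`) and `tendsto_fluxBound`. [cite: DuchonRobert2000, proof of Prop. 4 p. 253] [cite: DrivasEyink2019, proof of Thm. 2(ii) p. 11] -/
theorem tendsto_energyFlux_of_tendsto_L3
    {νseq : ℕ → ℝ} {useq : ℕ → ℝ → UnitAddTorus d → EuclideanSpace ℝ d}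
    {pseq : ℕ → ℝ → UnitAddTorus d → ℝ} {p : ℝ → UnitAddTorus d → ℝ}
    (hν : Tendsto νseq atTop (𝓝 0))
    (hmeas_seq : ∀ᶠ m in atTop,
      AEStronglyMeasurable (FunctionSpaces.Torus.stLift (useq m)) (volume.restrict (Ioo 0 T ×ˢ univ)) ∧
        AEStronglyMeasurable (FunctionSpaces.Torus.stLift (pseq m)) (volume.restrict (Ioo 0 T ×ˢ univ)))
    (hmeas : AEStronglyMeasurable (FunctionSpaces.Torus.stLift u) (volume.restrict (Ioo 0 T ×ˢ univ)))
    (hpmeas : AEStronglyMeasurable (FunctionSpaces.Torus.stLift p) (volume.restrict (Ioo 0 T ×ˢ univ)))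
    (hconv : Tendsto (fun m => ∫⁻ t in Ioo 0 T, ∫⁻ x, ‖useq m t x - u t x‖ₑ ^ (3 : ℕ)) atTop (𝓝 0))
    (hu3 : ∫⁻ t in Ioo 0 T, ∫⁻ x, ‖u t x‖ₑ ^ (3 : ℕ) < ∞)
    (hpconv : Tendsto (fun m => ∫⁻ t in Ioo 0 T, ∫⁻ x, ‖pseq m t x - p t x‖ₑ ^ (3 / 2 : ℝ))
      atTop (𝓝 0))
    (hp : ∫⁻ t in Ioo 0 T, ∫⁻ x, ‖p t x‖ₑ ^ (3 / 2 : ℝ) < ∞)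
    {ψ : ℝ → UnitAddTorus d → ℝ} (hψ : FunctionSpaces.Torus.IsSpaceTimeTestIoo T ψ) :
    Tendsto (fun m => ∫ t in Ioo 0 T, ∫ x,
        (2⁻¹ * ‖useq m t x‖ ^ 2 * FunctionSpaces.Torus.timeDeriv ψ t x +
          (2⁻¹ * ‖useq m t x‖ ^ 2 + pseq m t x) * ⟪useq m t x, FunctionSpaces.Torus.gradient (ψ t) x⟫ +
          2⁻¹ * νseq m * ‖useq m t x‖ ^ 2 * FunctionSpaces.Torus.laplacian (ψ t) x)) atTop
      (𝓝 (∫ t in Ioo 0 T, ∫ x, (2⁻¹ * ‖u t x‖ ^ 2 * FunctionSpaces.Torus.timeDeriv ψ t x +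
          (2⁻¹ * ‖u t x‖ ^ 2 + p t x) * ⟪u t x, FunctionSpaces.Torus.gradient (ψ t) x⟫))) := by
  set μT := (volume.restrict (Ioo 0 T)).prod (volume : Measure (UnitAddTorus d)) with hμT
  -- measurability in product form
  have hum : AEStronglyMeasurable (uncurry u) μT := aestronglyMeasurable_uncurry_prod hmeas
  have hpm : AEStronglyMeasurable (uncurry p) μT := aestronglyMeasurable_uncurry_prod hpmeas
  have hm : ∀ᶠ m in atTop, AEStronglyMeasurable (uncurry (useq m)) μT ∧
      AEStronglyMeasurable (uncurry (pseq m)) μT :=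
    hmeas_seq.mono fun m h =>
      ⟨aestronglyMeasurable_uncurry_prod h.1, aestronglyMeasurable_uncurry_prod h.2⟩
  -- the test-derived fields
  obtain ⟨-, hdt, hgr, hla⟩ := hψ.isSpaceTimeTest.isSmoothSpaceTimeOn_derived
  obtain ⟨⟨Cdt, hCdt0, hCdt⟩, -⟩ := hdt.bound_and_measurable T
  obtain ⟨⟨Cgr, hCgr0, hCgr⟩, -⟩ := hgr.bound_and_measurable T
  obtain ⟨⟨Cla, hCla0, hCla⟩, -⟩ := hla.bound_and_measurable T
  -- `L³`/`L^{3/2}` finiteness of the approximants, eventually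
  have hconv' : Tendsto (fun m => ∫⁻ t in Ioo 0 T, ∫⁻ x, ‖useq m t x - u t x‖ₑ ^ (3 : ℝ))
      atTop (𝓝 0) := by
    simpa only [ENNReal.rpow_ofNat] using hconv
  have hu3r : ∫⁻ t in Ioo 0 T, ∫⁻ x, ‖u t x‖ₑ ^ (3 : ℝ) < ∞ := by
    simpa only [ENNReal.rpow_ofNat] using hu3
  have hu3m : ∀ᶠ m in atTop, ∫⁻ t in Ioo 0 T, ∫⁻ x, ‖useq m t x‖ₑ ^ (3 : ℕ) < ∞ :=
    eventually_lintegral_enorm_pow_three_lt_top (hm.mono fun m h => h.1) hum hconv hu3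
  have hp32m : ∀ᶠ m in atTop, ∫⁻ t in Ioo 0 T, ∫⁻ x, ‖pseq m t x‖ₑ ^ (3 / 2 : ℝ) < ∞ :=
    eventually_lintegral_enorm_rpow_lt_top (by norm_num) (hm.mono fun m h => h.2) hpm hpconv hp
  -- integrability of the flux integrands
  have IF : Integrable (fun z : ℝ × UnitAddTorus d => 2⁻¹ * ‖u z.1 z.2‖ ^ 2 * FunctionSpaces.Torus.timeDeriv ψ z.1 z.2 +
      (2⁻¹ * ‖u z.1 z.2‖ ^ 2 + p z.1 z.2) * ⟪u z.1 z.2, FunctionSpaces.Torus.gradient (ψ z.1) z.2⟫) μT := by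
    have h := integrable_energyFluxIntegrand 0 hum hu3 hpm hp hψ.isSpaceTimeTest
    refine h.congr (Eventually.of_forall fun z => ?_)
    simp only [mul_zero, zero_mul, add_zero]
  have IFm : ∀ᶠ m in atTop, Integrable (fun z : ℝ × UnitAddTorus d =>
      2⁻¹ * ‖useq m z.1 z.2‖ ^ 2 * FunctionSpaces.Torus.timeDeriv ψ z.1 z.2 +
        (2⁻¹ * ‖useq m z.1 z.2‖ ^ 2 + pseq m z.1 z.2) * ⟪useq m z.1 z.2, FunctionSpaces.Torus.gradient (ψ z.1) z.2⟫ +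
        2⁻¹ * νseq m * ‖useq m z.1 z.2‖ ^ 2 * FunctionSpaces.Torus.laplacian (ψ z.1) z.2) μT := by
    filter_upwards [hm, hu3m, hp32m] with m h1 h2 h3
    exact integrable_energyFluxIntegrand (νseq m) h1.1 h2 h1.2 h3 hψ.isSpaceTimeTest
  -- reduction to product integrals
  rw [show (∫ t in Ioo 0 T, ∫ x, (2⁻¹ * ‖u t x‖ ^ 2 * FunctionSpaces.Torus.timeDeriv ψ t x +
      (2⁻¹ * ‖u t x‖ ^ 2 + p t x) * ⟪u t x, FunctionSpaces.Torus.gradient (ψ t) x⟫)) =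
      ∫ z, (2⁻¹ * ‖u z.1 z.2‖ ^ 2 * FunctionSpaces.Torus.timeDeriv ψ z.1 z.2 +
        (2⁻¹ * ‖u z.1 z.2‖ ^ 2 + p z.1 z.2) * ⟪u z.1 z.2, FunctionSpaces.Torus.gradient (ψ z.1) z.2⟫) ∂μT
      from (integral_prod _ IF).symm]
  have em : ∀ᶠ m in atTop, (∫ z, (2⁻¹ * ‖useq m z.1 z.2‖ ^ 2 * FunctionSpaces.Torus.timeDeriv ψ z.1 z.2 +
        (2⁻¹ * ‖useq m z.1 z.2‖ ^ 2 + pseq m z.1 z.2) * ⟪useq m z.1 z.2, FunctionSpaces.Torus.gradient (ψ z.1) z.2⟫ +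
        2⁻¹ * νseq m * ‖useq m z.1 z.2‖ ^ 2 * FunctionSpaces.Torus.laplacian (ψ z.1) z.2) ∂μT) =
      ∫ t in Ioo 0 T, ∫ x, (2⁻¹ * ‖useq m t x‖ ^ 2 * FunctionSpaces.Torus.timeDeriv ψ t x +
        (2⁻¹ * ‖useq m t x‖ ^ 2 + pseq m t x) * ⟪useq m t x, FunctionSpaces.Torus.gradient (ψ t) x⟫ +
        2⁻¹ * νseq m * ‖useq m t x‖ ^ 2 * FunctionSpaces.Torus.laplacian (ψ t) x) :=
    IFm.mono fun m h => integral_prod _ h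
  refine (tendsto_integral_of_L1 _ IF.aestronglyMeasurable IFm ?_).congr' em
  -- the `L¹` distance → 0: atoms
  have mNb : AEMeasurable (fun z : ℝ × UnitAddTorus d => ‖u z.1 z.2‖ₑ) μT := hum.enorm
  have mQq : AEMeasurable (fun z : ℝ × UnitAddTorus d => ‖p z.1 z.2‖ₑ) μT := hpm.enorm
  have mE : ∀ᶠ m in atTop, AEMeasurable (fun z : ℝ × UnitAddTorus d => ‖useq m z.1 z.2 - u z.1 z.2‖ₑ) μT ∧
      AEMeasurable (fun z : ℝ × UnitAddTorus d => ‖pseq m z.1 z.2 - p z.1 z.2‖ₑ) μT := by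
    filter_upwards [hm] with m h
    exact ⟨(show AEStronglyMeasurable (fun z : ℝ × UnitAddTorus d => useq m z.1 z.2 - u z.1 z.2) μT
      from h.1.sub hum).enorm,
      (show AEStronglyMeasurable (fun z : ℝ × UnitAddTorus d => pseq m z.1 z.2 - p z.1 z.2) μT
      from h.2.sub hpm).enorm⟩
  have hA : Tendsto (fun m => ∫⁻ z, ‖useq m z.1 z.2 - u z.1 z.2‖ₑ ^ (3 : ℝ) ∂μT) atTop (𝓝 0) := by
    refine hconv'.congr' ?_
    filter_upwards [mE] with m h
    have e : ∫⁻ t in Ioo 0 T, ∫⁻ x, ‖useq m t x - u t x‖ₑ ^ (3 : ℝ) =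
        ∫⁻ z, ‖useq m z.1 z.2 - u z.1 z.2‖ₑ ^ (3 : ℝ) ∂μT :=
      lintegral_Ioo_lintegral_eq_lintegral_prod (h.1.pow_const _)
    exact e
  have hB : Tendsto (fun m => (∫⁻ z, ‖pseq m z.1 z.2 - p z.1 z.2‖ₑ ^ (3 / 2 : ℝ) ∂μT) ^ (2 / 3 : ℝ))
      atTop (𝓝 0) := by
    have hB0 : Tendsto (fun m => ∫⁻ z, ‖pseq m z.1 z.2 - p z.1 z.2‖ₑ ^ (3 / 2 : ℝ) ∂μT) atTop (𝓝 0) := by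
      refine hpconv.congr' ?_
      filter_upwards [mE] with m h
      have e : ∫⁻ t in Ioo 0 T, ∫⁻ x, ‖pseq m t x - p t x‖ₑ ^ (3 / 2 : ℝ) =
          ∫⁻ z, ‖pseq m z.1 z.2 - p z.1 z.2‖ₑ ^ (3 / 2 : ℝ) ∂μT :=
        lintegral_Ioo_lintegral_eq_lintegral_prod (h.2.pow_const _)
      exact e
    have := ((ENNReal.continuous_rpow_const (y := (2 / 3 : ℝ))).tendsto 0).comp hB0
    rwa [ENNReal.zero_rpow_of_pos (by norm_num)] at this
  have hU3 : ∫⁻ z, ‖u z.1 z.2‖ₑ ^ (3 : ℝ) ∂μT < ∞ := by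
    have e : ∫⁻ t in Ioo 0 T, ∫⁻ x, ‖u t x‖ₑ ^ (3 : ℝ) = ∫⁻ z, ‖u z.1 z.2‖ₑ ^ (3 : ℝ) ∂μT :=
      lintegral_Ioo_lintegral_eq_lintegral_prod (mNb.pow_const _)
    rw [← e]; exact hu3r
  have hP32 : ∫⁻ z, ‖p z.1 z.2‖ₑ ^ (3 / 2 : ℝ) ∂μT < ∞ := by
    have e : ∫⁻ t in Ioo 0 T, ∫⁻ x, ‖p t x‖ₑ ^ (3 / 2 : ℝ) = ∫⁻ z, ‖p z.1 z.2‖ₑ ^ (3 / 2 : ℝ) ∂μT :=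
      lintegral_Ioo_lintegral_eq_lintegral_prod (mQq.pow_const _)
    rw [← e]; exact hp
  have hN32 : ∫⁻ z, ‖u z.1 z.2‖ₑ ^ (3 / 2 : ℝ) ∂μT < ∞ :=
    lintegral_enorm_rpow_three_halves_lt_top (f := uncurry u) hum hU3
  have hν' : Tendsto (fun m => ‖νseq m‖ₑ) atTop (𝓝 0) := by
    have := (continuous_enorm.tendsto (0 : ℝ)).comp hν
    rwa [enorm_zero] at this
  -- a.e. `t ∈ (0, T)` and the test bounds
  have hIoo : ∀ᵐ z ∂μT, z.1 ∈ Icc 0 T := by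
    rw [hμT, ← volume_restrict_Ioo_prod_univ]
    filter_upwards [ae_restrict_mem (measurableSet_Ioo.prod MeasurableSet.univ)] with z hz
    exact Ioo_subset_Icc_self hz.1
  have bdt : ∀ᵐ z ∂μT, |FunctionSpaces.Torus.timeDeriv ψ z.1 z.2| ≤ Cdt := by
    filter_upwards [hIoo] with z hz
    simpa [Real.norm_eq_abs] using hCdt z.1 hz z.2
  have bgr : ∀ᵐ z ∂μT, ‖FunctionSpaces.Torus.gradient (ψ z.1) z.2‖ ≤ Cgr := by
    filter_upwards [hIoo] with z hz
    exact hCgr z.1 hz z.2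
  have bla : ∀ᵐ z ∂μT, |FunctionSpaces.Torus.laplacian (ψ z.1) z.2| ≤ Cla := by
    filter_upwards [hIoo] with z hz
    simpa [Real.norm_eq_abs] using hCla z.1 hz z.2
  -- squeeze
  have hlim := tendsto_fluxBound (c₁ := ENNReal.ofReal Cdt) (c₂ := ENNReal.ofReal Cgr)
    (c₃ := ENNReal.ofReal Cla) ENNReal.ofReal_ne_top ENNReal.ofReal_ne_top ENNReal.ofReal_ne_top
    hU3.ne (ENNReal.rpow_ne_top_of_nonneg (y := 2 / 3) (by norm_num) hP32.ne)
    (ENNReal.rpow_ne_top_of_nonneg (y := 2 / 3) (by norm_num) hN32.ne)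
    (ENNReal.rpow_ne_top_of_nonneg (y := 1 / 3) (by norm_num) (measure_ne_top μT univ)) hA hB hν'
  refine tendsto_of_tendsto_of_tendsto_of_le_of_le' tendsto_const_nhds hlim
    (Eventually.of_forall fun _ => zero_le) ?_
  filter_upwards [mE] with m hmE
  exact lintegral_enorm_energyFlux_sub_le μT (νseq m) bdt bgr bla hmE.1 mNb hmE.2 mQq

end FluxLimit

/-! ## Strong inviscid limits of weak Navier–Stokes solutions are weak Euler solutions -/

section InviscidLimit

/-- From `∫⁻ g_m → 0` along `m → ∞`, a subsequence converges to `0` almost everywhere: choose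
`φ` with `∫⁻ g_{φ k} ≤ 2^{-k}`, so that `∑ₖ g_{φ k}` has finite integral, hence is finite a.e.,
and its terms tend to `0` (the standard "fast `L¹` subsequence" argument). [folklore] -/
theorem exists_subseq_tendsto_ae_of_tendsto_lintegral {α : Type*} [MeasurableSpace α]
    {μ : Measure α} {g : ℕ → α → ℝ≥0∞} (hg : ∀ m, AEMeasurable (g m) μ)
    (h : Tendsto (fun m => ∫⁻ a, g m a ∂μ) atTop (𝓝 0)) :
    ∃ φ : ℕ → ℕ, StrictMono φ ∧ ∀ᵐ a ∂μ, Tendsto (fun k => g (φ k) a) atTop (𝓝 0) := by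
  have hev : ∀ k : ℕ, ∀ᶠ m in atTop, ∫⁻ a, g m a ∂μ ≤ (2⁻¹ : ℝ≥0∞) ^ k := fun k =>
    h.eventually (eventually_le_nhds (ENNReal.pow_pos (ENNReal.inv_pos.2 ENNReal.ofNat_ne_top) k))
  obtain ⟨φ, hφ, hle⟩ := extraction_forall_of_eventually hev
  refine ⟨φ, hφ, ?_⟩
  have hsum : ∫⁻ a, ∑' k, g (φ k) a ∂μ ≠ ∞ := by
    rw [lintegral_tsum fun k => hg (φ k)]
    refine ne_top_of_le_ne_top ?_ (ENNReal.tsum_le_tsum hle)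
    rw [ENNReal.tsum_geometric, ENNReal.one_sub_inv_two, inv_inv]
    exact ENNReal.ofNat_ne_top
  filter_upwards [ae_lt_top' (AEMeasurable.tsum fun k => hg (φ k)) hsum] with a ha
  exact ENNReal.tendsto_atTop_zero_of_tsum_ne_top ha.ne

/-- The torus gradient of a smooth scalar function is bounded (continuity on the compact
torus). [folklore] -/
theorem _root_.Literature.Analysis.FunctionSpaces.Torus.IsSmooth.exists_norm_gradient_le {θ : UnitAddTorus d → ℝ} (hθ : FunctionSpaces.Torus.IsSmooth θ) :
    ∃ C : ℝ, 0 ≤ C ∧ ∀ x, ‖FunctionSpaces.Torus.gradient θ x‖ ≤ C := by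
  obtain ⟨C, hC⟩ := isCompact_univ.exists_bound_of_continuousOn
    (hθ.gradient.continuous.continuousOn (s := univ))
  exact ⟨max C 0, le_max_right _ _, fun x => (hC x (mem_univ x)).trans (le_max_left _ _)⟩

/-- The pairing of an `L²` slice with a bounded field is small with the `L²` norm:
`‖∫ ⟪w, g⟫‖ₑ ≤ C (∫⁻ ‖w‖ₑ²)^{1/2}` on the probability space `T^d` when `‖g‖ ≤ C`. [folklore] -/
theorem enorm_integral_inner_le {w g : UnitAddTorus d → EuclideanSpace ℝ d}
    (hw : AEStronglyMeasurable w volume) {C : ℝ} (hC0 : 0 ≤ C) (hC : ∀ x, ‖g x‖ ≤ C) :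
    ‖∫ x, ⟪w x, g x⟫‖ₑ ≤ ENNReal.ofReal C * (∫⁻ x, ‖w x‖ₑ ^ 2) ^ (1 / 2 : ℝ) := by
  calc ‖∫ x, ⟪w x, g x⟫‖ₑ ≤ ∫⁻ x, ‖⟪w x, g x⟫‖ₑ := enorm_integral_le_lintegral_enorm _
    _ ≤ ∫⁻ x, ENNReal.ofReal C * ‖w x‖ₑ := by
        refine lintegral_mono fun x => ?_
        rw [Real.enorm_eq_ofReal_abs, ← ofReal_norm, ← ENNReal.ofReal_mul hC0]
        refine ENNReal.ofReal_le_ofReal ((abs_real_inner_le_norm _ _).trans ?_)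
        rw [mul_comm]
        exact mul_le_mul_of_nonneg_right (hC x) (norm_nonneg _)
    _ = ENNReal.ofReal C * eLpNorm w 1 volume := by
        rw [lintegral_const_mul' _ _ ENNReal.ofReal_ne_top, eLpNorm_one_eq_lintegral_enorm]
    _ ≤ ENNReal.ofReal C * eLpNorm w 2 volume := by
        gcongr
        exact eLpNorm_le_eLpNorm_of_exponent_le one_le_two hw
    _ = ENNReal.ofReal C * (∫⁻ x, ‖w x‖ₑ ^ 2) ^ (1 / 2 : ℝ) := by
        rw [eLpNorm_eq_lintegral_rpow_enorm_toReal two_ne_zero ENNReal.ofNat_ne_top]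
        simp only [ENNReal.toReal_ofNat, ENNReal.rpow_ofNat]

/-- **Weak divergence-freeness passes to strong `L²_{t,x}` limits.** If the `u_m` are jointly
measurable on `(0,T) × T^d` with weakly divergence-free slices for a.e. `t`, `u` is jointly
measurable and in `L²_{t,x}`, and `u_m → u` in `L²((0,T) × T^d)`, then `u t` is weakly
divergence free for a.e. `t ∈ (0,T)`: along a subsequence `u_{φ k} t → u t` in `L²(T^d)` for
a.e. `t` (`exists_subseq_tendsto_ae_of_tendsto_lintegral`), and `∫ ⟪·, ∇θ⟫` is continuous on
`L²(T^d)` (Temam, Ch. I §1.4: the space `H` is closed in `L²`). [folklore] -/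
theorem ae_isWeaklyDivFree_of_tendsto_lintegral
    {useq : ℕ → ℝ → UnitAddTorus d → EuclideanSpace ℝ d}
    {u : ℝ → UnitAddTorus d → EuclideanSpace ℝ d}
    (hmeas_seq : ∀ m, AEStronglyMeasurable (uncurry (useq m)) ((volume.restrict (Ioo 0 T)).prod volume))
    (hdiv : ∀ m, ∀ᵐ t ∂(volume.restrict (Ioo 0 T)), FunctionSpaces.Torus.IsWeaklyDivFree (useq m t))
    (hmeas : AEStronglyMeasurable (uncurry u) ((volume.restrict (Ioo 0 T)).prod volume))
    (hu2 : ∫⁻ t in Ioo 0 T, ∫⁻ x, ‖u t x‖ₑ ^ 2 < ∞)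
    (hconv : Tendsto (fun m => ∫⁻ t in Ioo 0 T, ∫⁻ x, ‖useq m t x - u t x‖ₑ ^ 2) atTop (𝓝 0)) :
    ∀ᵐ t ∂(volume.restrict (Ioo 0 T)), FunctionSpaces.Torus.IsWeaklyDivFree (u t) := by
  set μt : Measure ℝ := volume.restrict (Ioo 0 T) with hμt
  have hdm : ∀ m, AEStronglyMeasurable (uncurry fun t x => useq m t x - u t x) (μt.prod volume) :=
    fun m => (hmeas_seq m).sub hmeas
  have hg : ∀ m, AEMeasurable (fun t => ∫⁻ x, ‖useq m t x - u t x‖ₑ ^ 2) μt := fun m =>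
    ((hdm m).enorm.pow_const _).lintegral_prod_right'
  obtain ⟨φ, -, hae⟩ := exists_subseq_tendsto_ae_of_tendsto_lintegral hg hconv
  have hslice_u : ∀ᵐ t ∂μt, AEStronglyMeasurable (u t) volume := hmeas.prodMk_left
  have hslice_seq : ∀ᵐ t ∂μt, ∀ m, AEStronglyMeasurable (useq m t) volume :=
    ae_all_iff.2 fun m => (hmeas_seq m).prodMk_left
  have hfin_u : ∀ᵐ t ∂μt, ∫⁻ x, ‖u t x‖ₑ ^ 2 < ∞ :=
    ae_lt_top' ((hmeas.enorm.pow_const _).lintegral_prod_right') hu2.ne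
  have hdiv' : ∀ᵐ t ∂μt, ∀ m, FunctionSpaces.Torus.IsWeaklyDivFree (useq m t) := ae_all_iff.2 hdiv
  filter_upwards [hae, hslice_u, hslice_seq, hfin_u, hdiv'] with t ht hut hst hu2t hdivt
  intro θ hθ
  obtain ⟨C, hC0, hC⟩ := hθ.exists_norm_gradient_le
  have hθm : AEStronglyMeasurable (FunctionSpaces.Torus.gradient θ) volume :=
    hθ.gradient.continuous.aestronglyMeasurable
  have hpair : ∀ {w : UnitAddTorus d → EuclideanSpace ℝ d}, AEStronglyMeasurable w volume →
      ∫⁻ x, ‖w x‖ₑ ^ 2 < ∞ → Integrable (fun x => ⟪w x, FunctionSpaces.Torus.gradient θ x⟫) volume := by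
    intro w hwm hw2
    have hW2 : MemLp w 2 volume := ⟨hwm, (eLpNorm_lt_top_iff_lintegral_rpow_enorm_lt_top
      two_ne_zero ENNReal.ofNat_ne_top).2 (by simpa using hw2)⟩
    refine Integrable.mono' ((hW2.integrable one_le_two).norm.mul_const C) (hwm.inner hθm) ?_
    refine Eventually.of_forall fun x => ?_
    rw [Real.norm_eq_abs]
    exact (abs_real_inner_le_norm _ _).trans (mul_le_mul_of_nonneg_left (hC x) (norm_nonneg _))
  have hint_u := hpair hut hu2t
  -- the bound along the subsequence
  have hbound : ∀ᶠ j in atTop, ‖∫ x, ⟪u t x, FunctionSpaces.Torus.gradient θ x⟫‖ₑ ≤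
      ENNReal.ofReal C * (∫⁻ x, ‖useq (φ j) t x - u t x‖ₑ ^ 2) ^ (1 / 2 : ℝ) := by
    have hfin : ∀ᶠ j in atTop, ∫⁻ x, ‖useq (φ j) t x - u t x‖ₑ ^ 2 < ∞ :=
      ht.eventually (eventually_lt_nhds ENNReal.zero_lt_top)
    filter_upwards [hfin] with j hj
    have hwm : AEStronglyMeasurable (fun x => useq (φ j) t x - u t x) volume := (hst (φ j)).sub hut
    have hint_w := hpair hwm hj
    have hsplit : ∫ x, ⟪u t x, FunctionSpaces.Torus.gradient θ x⟫ =
        -∫ x, ⟪useq (φ j) t x - u t x, FunctionSpaces.Torus.gradient θ x⟫ := by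
      have h0 : ∫ x, ⟪useq (φ j) t x, FunctionSpaces.Torus.gradient θ x⟫ = 0 := hdivt (φ j) θ hθ
      have heq : (fun x => ⟪useq (φ j) t x, FunctionSpaces.Torus.gradient θ x⟫) =
          fun x => ⟪useq (φ j) t x - u t x, FunctionSpaces.Torus.gradient θ x⟫ + ⟪u t x, FunctionSpaces.Torus.gradient θ x⟫ := by
        funext x
        rw [inner_sub_left, sub_add_cancel]
      rw [heq, integral_add hint_w hint_u] at h0
      linarith
    rw [hsplit, enorm_neg]
    exact enorm_integral_inner_le hwm hC0 hC
  have hlim : Tendsto (fun j => ENNReal.ofReal C *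
      (∫⁻ x, ‖useq (φ j) t x - u t x‖ₑ ^ 2) ^ (1 / 2 : ℝ)) atTop (𝓝 0) := by
    have h1 := ((ENNReal.continuous_rpow_const (y := (1 / 2 : ℝ))).tendsto 0).comp ht
    rw [ENNReal.zero_rpow_of_pos (by norm_num)] at h1
    have h2 := ENNReal.Tendsto.const_mul h1 (a := ENNReal.ofReal C) (Or.inr ENNReal.ofReal_ne_top)
    rwa [mul_zero] at h2
  have h0 : ‖∫ x, ⟪u t x, FunctionSpaces.Torus.gradient θ x⟫‖ₑ ≤ 0 := ge_of_tendsto hlim hbound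
  simpa using h0

end InviscidLimit

section InviscidLimitMomentum

/-- Pointwise algebra behind the inviscid limit of the weak momentum equation: with
`e = ‖a - b‖`, `|⟪a, δ⟫ + ⟪a, B a⟫ + ν⟪a, L⟫ − ⟪b, δ⟫ − ⟪b, B b⟫ − 0·⟪b, L⟫|` is at most
`C_δ e + C_B (e² + 2|b|e) + |ν| C_L (e + |b|)`. [folklore] -/
theorem abs_momentumFlux_sub_le {E' : Type*} [NormedAddCommGroup E'] [InnerProductSpace ℝ E']
    (a b δ L : E') (B : E' →L[ℝ] E') (ν Cδ CB CL : ℝ)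
    (hδ : ‖δ‖ ≤ Cδ) (hB : ‖B‖ ≤ CB) (hL : ‖L‖ ≤ CL) :
    |(⟪a, δ⟫ + ⟪a, B a⟫ + ν * ⟪a, L⟫) - (⟪b, δ⟫ + ⟪b, B b⟫ + 0 * ⟪b, L⟫)| ≤
      Cδ * ‖a - b‖ + CB * (‖a - b‖ ^ 2 + 2 * (‖b‖ * ‖a - b‖)) +
        |ν| * CL * (‖a - b‖ + ‖b‖) := by
  set e := ‖a - b‖ with he
  have he0 : 0 ≤ e := norm_nonneg _
  have hb0 : 0 ≤ ‖b‖ := norm_nonneg _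
  have hCB0 : 0 ≤ CB := (norm_nonneg _).trans hB
  have hCδ0 : 0 ≤ Cδ := (norm_nonneg _).trans hδ
  have hCL0 : 0 ≤ CL := (norm_nonneg _).trans hL
  have hna : ‖a‖ ≤ e + ‖b‖ := by
    have := norm_le_norm_add_norm_sub' a b
    linarith
  have hdec : (⟪a, δ⟫ + ⟪a, B a⟫ + ν * ⟪a, L⟫) - (⟪b, δ⟫ + ⟪b, B b⟫ + 0 * ⟪b, L⟫) =
      ⟪a - b, δ⟫ + (⟪a - b, B a⟫ + ⟪b, B (a - b)⟫) + ν * ⟪a, L⟫ := by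
    rw [map_sub, inner_sub_left, inner_sub_left, inner_sub_right]
    ring
  rw [hdec]
  have h1 : |⟪a - b, δ⟫| ≤ Cδ * e := by
    rw [mul_comm]
    exact (abs_real_inner_le_norm _ _).trans (mul_le_mul_of_nonneg_left hδ he0)
  have hBv : ∀ v : E', ‖B v‖ ≤ CB * ‖v‖ := fun v =>
    (B.le_opNorm v).trans (mul_le_mul_of_nonneg_right hB (norm_nonneg _))
  have h2 : |⟪a - b, B a⟫ + ⟪b, B (a - b)⟫| ≤ CB * (e ^ 2 + 2 * (‖b‖ * e)) := by
    have h2a : |⟪a - b, B a⟫| ≤ e * (CB * (e + ‖b‖)) :=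
      (abs_real_inner_le_norm _ _).trans (mul_le_mul_of_nonneg_left
        ((hBv a).trans (mul_le_mul_of_nonneg_left hna hCB0)) he0)
    have h2b : |⟪b, B (a - b)⟫| ≤ ‖b‖ * (CB * e) :=
      (abs_real_inner_le_norm _ _).trans (mul_le_mul_of_nonneg_left (hBv _) hb0)
    refine (abs_add_le _ _).trans ((add_le_add h2a h2b).trans (le_of_eq ?_))
    ring
  have h3 : |ν * ⟪a, L⟫| ≤ |ν| * CL * (e + ‖b‖) := by
    rw [abs_mul]
    have : |⟪a, L⟫| ≤ (e + ‖b‖) * CL :=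
      (abs_real_inner_le_norm _ _).trans (mul_le_mul hna hL (norm_nonneg _) (by positivity))
    calc |ν| * |⟪a, L⟫| ≤ |ν| * ((e + ‖b‖) * CL) := mul_le_mul_of_nonneg_left this (abs_nonneg _)
      _ = |ν| * CL * (e + ‖b‖) := by ring
  calc |⟪a - b, δ⟫ + (⟪a - b, B a⟫ + ⟪b, B (a - b)⟫) + ν * ⟪a, L⟫|
      ≤ |⟪a - b, δ⟫| + |⟪a - b, B a⟫ + ⟪b, B (a - b)⟫| + |ν * ⟪a, L⟫| :=
        (abs_add_le _ _).trans (add_le_add ((abs_add_le _ _).trans le_rfl) le_rfl)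
    _ ≤ _ := by linarith [h1, h2, h3]

/-- Pointwise bound of `abs_momentumFlux_sub_le`, cast to `ℝ≥0∞`. [folklore] -/
theorem enorm_momentumFlux_sub_le {E' : Type*} [NormedAddCommGroup E'] [InnerProductSpace ℝ E']
    (a b δ L : E') (B : E' →L[ℝ] E') (ν Cδ CB CL : ℝ)
    (hδ : ‖δ‖ ≤ Cδ) (hB : ‖B‖ ≤ CB) (hL : ‖L‖ ≤ CL) :
    ‖(⟪a, δ⟫ + ⟪a, B a⟫ + ν * ⟪a, L⟫) - (⟪b, δ⟫ + ⟪b, B b⟫ + 0 * ⟪b, L⟫)‖ₑ ≤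
      ENNReal.ofReal Cδ * ‖a - b‖ₑ +
        ENNReal.ofReal CB * (‖a - b‖ₑ ^ 2 + 2 * (‖b‖ₑ * ‖a - b‖ₑ)) +
        ‖ν‖ₑ * ENNReal.ofReal CL * (‖a - b‖ₑ + ‖b‖ₑ) := by
  have hCB0 : 0 ≤ CB := (norm_nonneg _).trans hB
  have hCδ0 : 0 ≤ Cδ := (norm_nonneg _).trans hδ
  have hCL0 : 0 ≤ CL := (norm_nonneg _).trans hL
  have hreal := abs_momentumFlux_sub_le a b δ L B ν Cδ CB CL hδ hB hL
  rw [Real.enorm_eq_ofReal_abs]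
  refine (ENNReal.ofReal_le_ofReal hreal).trans (le_of_eq ?_)
  simp (disch := positivity) only [ENNReal.ofReal_add, ENNReal.ofReal_mul, ENNReal.ofReal_pow,
    ENNReal.ofReal_ofNat, ofReal_norm, ← Real.enorm_eq_ofReal_abs]

/-- The explicit majorant of the `L¹` distance of the weak momentum integrands furnished by the
Cauchy–Schwarz inequality (`lintegral_enorm_momentumFlux_sub_le`): `A = ∫∫|u_m-u|²`,
`N = ∫∫|u|²`, `M = T·1`, `n = |ν_m|`, and `c₁, c₂, c₃` bound `∂ₜψ`, `Dψ`, `Δψ`. [folklore] -/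
def momentumBound (c₁ c₂ c₃ n A N M : ℝ≥0∞) : ℝ≥0∞ :=
  c₁ * (A ^ (1 / 2 : ℝ) * M ^ (1 / 2 : ℝ)) +
    c₂ * (A + 2 * (N ^ (1 / 2 : ℝ) * A ^ (1 / 2 : ℝ))) +
    n * c₃ * (A ^ (1 / 2 : ℝ) * M ^ (1 / 2 : ℝ) + N ^ (1 / 2 : ℝ) * M ^ (1 / 2 : ℝ))

/-- **The `L¹` distance of the weak momentum integrands is controlled by `momentumBound`**
(pointwise algebra `enorm_momentumFlux_sub_le`, then Cauchy–Schwarz term by term). [folklore] -/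
theorem lintegral_enorm_momentumFlux_sub_le {α : Type*} [MeasurableSpace α] (μ : Measure α)
    {E' : Type*} [NormedAddCommGroup E'] [InnerProductSpace ℝ E']
    {a b δ L : α → E'} {B : α → E' →L[ℝ] E'} (ν : ℝ) {Cδ CB CL : ℝ}
    (hδ : ∀ᵐ x ∂μ, ‖δ x‖ ≤ Cδ) (hB : ∀ᵐ x ∂μ, ‖B x‖ ≤ CB) (hL : ∀ᵐ x ∂μ, ‖L x‖ ≤ CL)
    (ma : AEMeasurable (fun x => ‖a x - b x‖ₑ) μ) (mb : AEMeasurable (fun x => ‖b x‖ₑ) μ) :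
    ∫⁻ x, ‖(⟪a x, δ x⟫ + ⟪a x, B x (a x)⟫ + ν * ⟪a x, L x⟫) -
        (⟪b x, δ x⟫ + ⟪b x, B x (b x)⟫ + 0 * ⟪b x, L x⟫)‖ₑ ∂μ ≤
      momentumBound (ENNReal.ofReal Cδ) (ENNReal.ofReal CB) (ENNReal.ofReal CL) ‖ν‖ₑ
        (∫⁻ x, ‖a x - b x‖ₑ ^ 2 ∂μ) (∫⁻ x, ‖b x‖ₑ ^ 2 ∂μ) (μ univ) := by
  have hpt : ∀ᵐ x ∂μ, ‖(⟪a x, δ x⟫ + ⟪a x, B x (a x)⟫ + ν * ⟪a x, L x⟫) -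
        (⟪b x, δ x⟫ + ⟪b x, B x (b x)⟫ + 0 * ⟪b x, L x⟫)‖ₑ ≤
      ENNReal.ofReal Cδ * ‖a x - b x‖ₑ +
        ENNReal.ofReal CB * (‖a x - b x‖ₑ ^ 2 + 2 * (‖b x‖ₑ * ‖a x - b x‖ₑ)) +
        ‖ν‖ₑ * ENNReal.ofReal CL * (‖a x - b x‖ₑ + ‖b x‖ₑ) := by
    filter_upwards [hδ, hB, hL] with x h1 h2 h3
    exact enorm_momentumFlux_sub_le (a x) (b x) (δ x) (L x) (B x) ν Cδ CB CL h1 h2 h3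
  refine (lintegral_mono_ae hpt).trans ?_
  -- Cauchy–Schwarz for the monomials
  have CS : ∀ {f g : α → ℝ≥0∞}, AEMeasurable f μ → AEMeasurable g μ →
      ∫⁻ x, f x * g x ∂μ ≤ (∫⁻ x, f x ^ 2 ∂μ) ^ (1 / 2 : ℝ) * (∫⁻ x, g x ^ 2 ∂μ) ^ (1 / 2 : ℝ) := by
    intro f g hf hg
    have h := ENNReal.lintegral_mul_le_Lp_mul_Lq μ Real.HolderConjugate.two_two hf hg
    simp only [Pi.mul_apply, ENNReal.rpow_ofNat] at h
    convert h using 3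
  have M1 : ∫⁻ x, ‖a x - b x‖ₑ ∂μ ≤
      (∫⁻ x, ‖a x - b x‖ₑ ^ 2 ∂μ) ^ (1 / 2 : ℝ) * (μ univ) ^ (1 / 2 : ℝ) := by
    have h := CS ma aemeasurable_const (g := fun _ => 1)
    simp only [mul_one, one_pow, lintegral_const, one_mul] at h
    exact h
  have M2 : ∫⁻ x, ‖b x‖ₑ * ‖a x - b x‖ₑ ∂μ ≤
      (∫⁻ x, ‖b x‖ₑ ^ 2 ∂μ) ^ (1 / 2 : ℝ) * (∫⁻ x, ‖a x - b x‖ₑ ^ 2 ∂μ) ^ (1 / 2 : ℝ) :=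
    CS mb ma
  have M3 : ∫⁻ x, ‖b x‖ₑ ∂μ ≤ (∫⁻ x, ‖b x‖ₑ ^ 2 ∂μ) ^ (1 / 2 : ℝ) * (μ univ) ^ (1 / 2 : ℝ) := by
    have h := CS mb aemeasurable_const (g := fun _ => 1)
    simp only [mul_one, one_pow, lintegral_const, one_mul] at h
    exact h
  -- linearity of the lower integral
  have hc1 : ENNReal.ofReal Cδ ≠ ∞ := ENNReal.ofReal_ne_top
  have hc2 : ENNReal.ofReal CB ≠ ∞ := ENNReal.ofReal_ne_top
  have hc3 : ‖ν‖ₑ * ENNReal.ofReal CL ≠ ∞ := ENNReal.mul_ne_top enorm_ne_top ENNReal.ofReal_ne_top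
  have m1 : AEMeasurable (fun x => ‖a x - b x‖ₑ ^ 2) μ := ma.pow_const 2
  have m2 : AEMeasurable (fun x => 2 * (‖b x‖ₑ * ‖a x - b x‖ₑ)) μ := (mb.mul ma).const_mul _
  have m12 : AEMeasurable (fun x => ‖a x - b x‖ₑ ^ 2 + 2 * (‖b x‖ₑ * ‖a x - b x‖ₑ)) μ := m1.add m2
  have s1 : AEMeasurable (fun x => ENNReal.ofReal Cδ * ‖a x - b x‖ₑ) μ := ma.const_mul _
  have s2 : AEMeasurable (fun x => ENNReal.ofReal CB *
      (‖a x - b x‖ₑ ^ 2 + 2 * (‖b x‖ₑ * ‖a x - b x‖ₑ))) μ := m12.const_mul _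
  have s12 : AEMeasurable (fun x => ENNReal.ofReal Cδ * ‖a x - b x‖ₑ + ENNReal.ofReal CB *
      (‖a x - b x‖ₑ ^ 2 + 2 * (‖b x‖ₑ * ‖a x - b x‖ₑ))) μ := s1.add s2
  rw [lintegral_add_left' s12, lintegral_add_left' s1]
  rw [lintegral_const_mul' _ _ hc1, lintegral_const_mul' _ _ hc2, lintegral_const_mul' _ _ hc3]
  rw [lintegral_add_left' m1, lintegral_add_left' ma,
    lintegral_const_mul' _ _ ENNReal.ofNat_ne_top]
  unfold momentumBound
  exact add_le_add (add_le_add (mul_le_mul' le_rfl M1)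
    (mul_le_mul' le_rfl (add_le_add le_rfl (mul_le_mul' le_rfl M2))))
    (mul_le_mul' le_rfl (add_le_add M1 M3))

/-- `momentumBound → 0` along `A_m → 0`, `n_m → 0` when the fixed quantities are finite. [folklore] -/
theorem tendsto_momentumBound {c₁ c₂ c₃ N M : ℝ≥0∞} (hc₁ : c₁ ≠ ∞) (hc₂ : c₂ ≠ ∞) (hc₃ : c₃ ≠ ∞)
    (hN : N ≠ ∞) (hM : M ≠ ∞) {A n : ℕ → ℝ≥0∞} (hA : Tendsto A atTop (𝓝 0))
    (hn : Tendsto n atTop (𝓝 0)) :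
    Tendsto (fun m => momentumBound c₁ c₂ c₃ (n m) (A m) N M) atTop (𝓝 0) := by
  have hA12 : Tendsto (fun m => A m ^ (1 / 2 : ℝ)) atTop (𝓝 0) := by
    have := ((ENNReal.continuous_rpow_const (y := (1 / 2 : ℝ))).tendsto 0).comp hA
    rwa [ENNReal.zero_rpow_of_pos (by norm_num)] at this
  have hM12 : M ^ (1 / 2 : ℝ) ≠ ∞ := ENNReal.rpow_ne_top_of_nonneg (by norm_num) hM
  have hN12 : N ^ (1 / 2 : ℝ) ≠ ∞ := ENNReal.rpow_ne_top_of_nonneg (by norm_num) hN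
  have t1 : Tendsto (fun m => A m ^ (1 / 2 : ℝ) * M ^ (1 / 2 : ℝ)) atTop (𝓝 0) := by
    simpa using ENNReal.Tendsto.mul_const hA12 (Or.inr hM12)
  have t2 : Tendsto (fun m => 2 * (N ^ (1 / 2 : ℝ) * A m ^ (1 / 2 : ℝ))) atTop (𝓝 0) := by
    have h : Tendsto (fun m => N ^ (1 / 2 : ℝ) * A m ^ (1 / 2 : ℝ)) atTop (𝓝 0) := by
      simpa using ENNReal.Tendsto.const_mul hA12 (Or.inr hN12)
    simpa using ENNReal.Tendsto.const_mul h (Or.inr ENNReal.ofNat_ne_top)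
  have t3 : Tendsto (fun m => A m ^ (1 / 2 : ℝ) * M ^ (1 / 2 : ℝ) + N ^ (1 / 2 : ℝ) * M ^ (1 / 2 : ℝ))
      atTop (𝓝 (0 + N ^ (1 / 2 : ℝ) * M ^ (1 / 2 : ℝ))) := t1.add tendsto_const_nhds
  have t4 : Tendsto (fun m => n m * c₃ * (A m ^ (1 / 2 : ℝ) * M ^ (1 / 2 : ℝ) +
      N ^ (1 / 2 : ℝ) * M ^ (1 / 2 : ℝ))) atTop (𝓝 0) := by
    have hn' : Tendsto (fun m => n m * c₃) atTop (𝓝 0) := by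
      simpa using ENNReal.Tendsto.mul_const hn (Or.inr hc₃)
    have h := ENNReal.Tendsto.mul hn' (Or.inr (by
      rw [zero_add]; exact ENNReal.mul_ne_top hN12 hM12)) t3 (Or.inr ENNReal.zero_ne_top)
    simpa using h
  have g1 : Tendsto (fun m => c₁ * (A m ^ (1 / 2 : ℝ) * M ^ (1 / 2 : ℝ))) atTop (𝓝 0) := by
    simpa using ENNReal.Tendsto.const_mul t1 (Or.inr hc₁)
  have g2 : Tendsto (fun m => c₂ * (A m + 2 * (N ^ (1 / 2 : ℝ) * A m ^ (1 / 2 : ℝ)))) atTop (𝓝 0) := by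
    simpa using ENNReal.Tendsto.const_mul (hA.add t2) (Or.inr hc₂)
  simpa [momentumBound] using (g1.add g2).add t4

variable [DecidableEq d]

omit [DecidableEq d] in
open scoped ContDiff in
/-- The spatial Fréchet derivatives of the slices of a jointly smooth field form a jointly smooth
`CLM`-valued field (on time sets of unique differentiability): the lift of
`(t, x) ↦ D(u t)(x)` is `z ↦ D_{S × ℝ^d}(stLift u)(z) ∘ (0, ·)` (`fderiv_slice_apply`). [folklore] -/
theorem _root_.Literature.Analysis.FunctionSpaces.Torus.IsSmoothSpaceTimeOn.torusFderiv {F : Type*} [NormedAddCommGroup F] [NormedSpace ℝ F]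
    {S : Set ℝ} {w : ℝ → UnitAddTorus d → F}
    (hw : FunctionSpaces.Torus.IsSmoothSpaceTimeOn S w) (hS : UniqueDiffOn ℝ S) :
    FunctionSpaces.Torus.IsSmoothSpaceTimeOn S (fun t x => FunctionSpaces.Torus.fderiv (w t) x) := by
  have hU : UniqueDiffOn ℝ (S ×ˢ (univ : Set (EuclideanSpace ℝ d))) := hS.prod uniqueDiffOn_univ
  have hG : ContDiffOn ℝ ∞ (fun z => (fderivWithin ℝ (FunctionSpaces.Torus.stLift w) (S ×ˢ univ) z).comp
      (ContinuousLinearMap.inr ℝ ℝ (EuclideanSpace ℝ d))) (S ×ˢ (univ : Set (EuclideanSpace ℝ d))) :=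
    (hw.fderivWithin hU le_rfl).clm_comp contDiffOn_const
  refine hG.congr fun z hz => ?_
  obtain ⟨t, y⟩ := z
  have ht : t ∈ S := (mem_prod.1 hz).1
  ext1 v
  rw [FunctionSpaces.Torus.stLift_apply, hw.fderiv_slice_apply ht]
  rfl

/-- **Strong inviscid limits of weak Navier–Stokes solutions are weak Euler solutions.** Let
`u_m` be (eventually) pressure-free weak solutions of Navier–Stokes on `T^d × (0,T)`
(`Torus.IsWeakNSSolutionOn T ν_m u_m`) with `ν_m → 0`, and let `u` be jointly measurable, in
`L²((0,T) × T^d)`, with `u_m → u` strongly in `L²((0,T) × T^d)`. Then `u` is a weak solution of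
the incompressible Euler equations on `T^d × (0,T)` (`Torus.IsWeakEulerSolutionOn`): weak
divergence-freeness passes to `L²` limits slice-wise, `∫∫ ⟪u_m, ∂ₜψ⟫ → ∫∫ ⟪u, ∂ₜψ⟫`,
`∫∫ ⟪u_m, (u_m·∇)ψ⟫ → ∫∫ ⟪u, (u·∇)ψ⟫` (quadratic, strong `L²`), and `ν_m ∫∫ ⟪u_m, Δψ⟫ → 0`
(Drivas–Eyink 2019, Thm. 2(ii) and its proof, p. 10, where even weak convergence of `u^ν` and
`u^ν ⊗ u^ν` at a.e. time suffices; DiPerna–Majda 1987, §1; the step "`u` is a weak Euler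
solution" of Duchon–Robert 2000, Prop. 4). Hypothesis-minimal twin of
`Turb.weakLimit_isWeakEuler_of_strong` (no Leray–Hopf structure, no weak-* bound). Proof: weak
divergence-freeness passes to the limit (`ae_isWeaklyDivFree_of_tendsto_lintegral`), and in the
weak momentum equation the linear terms converge by `L²` convergence, the quadratic term by
Cauchy–Schwarz, and the viscous term is `O(ν_m ‖u_m‖₁) → 0`
(`lintegral_enorm_momentumFlux_sub_le`, `tendsto_momentumBound`). [cite: DrivasEyink2019, Thm. 2(ii) and proof p. 10] -/
theorem isWeakEulerSolutionOn_of_inviscidLimit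
    {νseq : ℕ → ℝ} {useq : ℕ → ℝ → UnitAddTorus d → EuclideanSpace ℝ d}
    (hν : Tendsto νseq atTop (𝓝 0))
    (hsol : ∀ᶠ m in atTop, FunctionSpaces.Torus.IsWeakNSSolutionOn T (νseq m) (useq m))
    (hmeas : AEStronglyMeasurable (FunctionSpaces.Torus.stLift u) (volume.restrict (Ioo 0 T ×ˢ univ)))
    (hu2 : ∫⁻ t in Ioo 0 T, ∫⁻ x, ‖u t x‖ₑ ^ 2 < ∞)
    (hconv : Tendsto (fun m => ∫⁻ t in Ioo 0 T, ∫⁻ x, ‖useq m t x - u t x‖ₑ ^ 2) atTop (𝓝 0)) :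
    FunctionSpaces.Torus.IsWeakEulerSolutionOn T u := by
  set μT := (volume.restrict (Ioo 0 T)).prod (volume : Measure (UnitAddTorus d)) with hμT
  -- shift the sequence so that every term is a weak solution
  obtain ⟨M₀, hM₀⟩ := eventually_atTop.1 hsol
  set vseq : ℕ → ℝ → UnitAddTorus d → EuclideanSpace ℝ d := fun k => useq (k + M₀) with hvseq
  set κ : ℕ → ℝ := fun k => νseq (k + M₀) with hκ
  have hshift : Tendsto (fun k : ℕ => k + M₀) atTop atTop := tendsto_add_atTop_nat M₀
  have hW : ∀ k, FunctionSpaces.Torus.IsWeakNSSolutionOn T (κ k) (vseq k) := fun k => hM₀ (k + M₀) (by omega)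
  have hκ0 : Tendsto κ atTop (𝓝 0) := hν.comp hshift
  have hvconv : Tendsto (fun k => ∫⁻ t in Ioo 0 T, ∫⁻ x, ‖vseq k t x - u t x‖ₑ ^ 2) atTop (𝓝 0) :=
    hconv.comp hshift
  have hum : AEStronglyMeasurable (uncurry u) μT := aestronglyMeasurable_uncurry_prod hmeas
  have hvm : ∀ k, AEStronglyMeasurable (uncurry (vseq k)) μT := fun k =>
    aestronglyMeasurable_uncurry_prod (hW k).1
  refine ⟨hmeas, hu2, ?_, fun ψ hψ hdiv => ?_⟩
  · exact ae_isWeaklyDivFree_of_tendsto_lintegral hvm (fun k => (hW k).2.2.1) hum hu2 hvconv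
  -- the test-derived fields: `∂ₜψ`, `Dψ`, `Δψ`
  have h0 : FunctionSpaces.Torus.IsSmoothSpaceTimeOn univ ψ := hψ.isSpaceTimeTest.isSmoothSpaceTimeOn univ
  have hdt : FunctionSpaces.Torus.IsSmoothSpaceTimeOn univ (FunctionSpaces.Torus.timeDeriv ψ) :=
    hψ.isSpaceTimeTest.timeDeriv.isSmoothSpaceTimeOn univ
  have hB : FunctionSpaces.Torus.IsSmoothSpaceTimeOn univ (fun t x => FunctionSpaces.Torus.fderiv (ψ t) x) :=
    h0.torusFderiv uniqueDiffOn_univ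
  have hL : FunctionSpaces.Torus.IsSmoothSpaceTimeOn univ (fun t => FunctionSpaces.Torus.laplacian (ψ t)) := h0.laplacian uniqueDiffOn_univ
  obtain ⟨⟨Cdt, hCdt0, hCdt⟩, hdtm⟩ := hdt.bound_and_measurable T
  obtain ⟨⟨CB, hCB0, hCB⟩, hBm⟩ := hB.bound_and_measurable T
  obtain ⟨⟨CL, hCL0, hCL⟩, hLm⟩ := hL.bound_and_measurable T
  -- a.e. `t ∈ (0, T)` and the test bounds
  have hIoo : ∀ᵐ z ∂μT, z.1 ∈ Icc 0 T := by
    rw [hμT, ← volume_restrict_Ioo_prod_univ]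
    filter_upwards [ae_restrict_mem (measurableSet_Ioo.prod MeasurableSet.univ)] with z hz
    exact Ioo_subset_Icc_self hz.1
  have bdt : ∀ᵐ z ∂μT, ‖FunctionSpaces.Torus.timeDeriv ψ z.1 z.2‖ ≤ Cdt := by
    filter_upwards [hIoo] with z hz
    exact hCdt z.1 hz z.2
  have bB : ∀ᵐ z ∂μT, ‖FunctionSpaces.Torus.fderiv (ψ z.1) z.2‖ ≤ CB := by
    filter_upwards [hIoo] with z hz
    exact hCB z.1 hz z.2
  have bL : ∀ᵐ z ∂μT, ‖FunctionSpaces.Torus.laplacian (ψ z.1) z.2‖ ≤ CL := by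
    filter_upwards [hIoo] with z hz
    exact hCL z.1 hz z.2
  -- integrability of the weak momentum integrands
  have hInt : ∀ {v : ℝ → UnitAddTorus d → EuclideanSpace ℝ d} (ν : ℝ),
      AEStronglyMeasurable (uncurry v) μT → (∫⁻ t in Ioo 0 T, ∫⁻ x, ‖v t x‖ₑ ^ 2 < ∞) →
      Integrable (fun z : ℝ × UnitAddTorus d => ⟪v z.1 z.2, FunctionSpaces.Torus.timeDeriv ψ z.1 z.2⟫ +
        ⟪v z.1 z.2, FunctionSpaces.Torus.fderiv (ψ z.1) z.2 (v z.1 z.2)⟫ +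
        ν * ⟪v z.1 z.2, FunctionSpaces.Torus.laplacian (ψ z.1) z.2⟫) μT := by
    intro v ν hv hv2
    have e2 : ∫⁻ t in Ioo 0 T, ∫⁻ x, ‖v t x‖ₑ ^ 2 = ∫⁻ z, ‖v z.1 z.2‖ₑ ^ 2 ∂μT :=
      lintegral_Ioo_lintegral_eq_lintegral_prod (hv.enorm.pow_const _)
    rw [e2] at hv2
    have hM2 : MemLp (uncurry v) 2 μT :=
      ⟨hv, (eLpNorm_lt_top_iff_lintegral_rpow_enorm_lt_top two_ne_zero ENNReal.ofNat_ne_top).2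
        (by simpa [uncurry] using hv2)⟩
    have I1 : Integrable (fun z => ‖v z.1 z.2‖) μT := (hM2.integrable one_le_two).norm
    have I2 : Integrable (fun z => ‖v z.1 z.2‖ ^ 2) μT := (memLp_two_iff_integrable_sq_norm hv).1 hM2
    have hBv : AEStronglyMeasurable (fun z : ℝ × UnitAddTorus d =>
        FunctionSpaces.Torus.fderiv (ψ z.1) z.2 (v z.1 z.2)) μT :=
      (show Continuous (fun p : (EuclideanSpace ℝ d →L[ℝ] EuclideanSpace ℝ d) × EuclideanSpace ℝ d =>
        p.1 p.2) from isBoundedBilinearMap_apply.continuous).comp_aestronglyMeasurable₂ hBm hv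
    have hmeasI : AEStronglyMeasurable (fun z : ℝ × UnitAddTorus d => ⟪v z.1 z.2, FunctionSpaces.Torus.timeDeriv ψ z.1 z.2⟫ +
        ⟪v z.1 z.2, FunctionSpaces.Torus.fderiv (ψ z.1) z.2 (v z.1 z.2)⟫ +
        ν * ⟪v z.1 z.2, FunctionSpaces.Torus.laplacian (ψ z.1) z.2⟫) μT :=
      ((hv.inner hdtm).add (hv.inner hBv)).add (aestronglyMeasurable_const.mul (hv.inner hLm))
    refine Integrable.mono' ((I1.const_mul (Cdt + |ν| * CL)).add (I2.const_mul CB)) hmeasI ?_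
    filter_upwards [bdt, bB, bL] with z h1 h2 h3
    set a := v z.1 z.2 with ha
    have ha0 : 0 ≤ ‖a‖ := norm_nonneg _
    have k1 : |⟪a, FunctionSpaces.Torus.timeDeriv ψ z.1 z.2⟫| ≤ ‖a‖ * Cdt :=
      (abs_real_inner_le_norm _ _).trans (mul_le_mul_of_nonneg_left h1 ha0)
    have k2 : |⟪a, FunctionSpaces.Torus.fderiv (ψ z.1) z.2 a⟫| ≤ ‖a‖ * (CB * ‖a‖) :=
      (abs_real_inner_le_norm _ _).trans (mul_le_mul_of_nonneg_left
        (((FunctionSpaces.Torus.fderiv (ψ z.1) z.2).le_opNorm a).trans (mul_le_mul_of_nonneg_right h2 ha0)) ha0)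
    have k3 : |ν * ⟪a, FunctionSpaces.Torus.laplacian (ψ z.1) z.2⟫| ≤ |ν| * (‖a‖ * CL) := by
      rw [abs_mul]
      exact mul_le_mul_of_nonneg_left ((abs_real_inner_le_norm _ _).trans
        (mul_le_mul_of_nonneg_left h3 ha0)) (abs_nonneg _)
    rw [Real.norm_eq_abs]
    refine (abs_add_le _ _).trans ((add_le_add ((abs_add_le _ _).trans (add_le_add k1 k2)) k3).trans ?_)
    simp only [Pi.add_apply]
    nlinarith [sq_nonneg ‖a‖]
  have IF : Integrable (fun z : ℝ × UnitAddTorus d => ⟪u z.1 z.2, FunctionSpaces.Torus.timeDeriv ψ z.1 z.2⟫ +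
      ⟪u z.1 z.2, FunctionSpaces.Torus.fderiv (ψ z.1) z.2 (u z.1 z.2)⟫ + 0 * ⟪u z.1 z.2, FunctionSpaces.Torus.laplacian (ψ z.1) z.2⟫) μT :=
    hInt 0 hum hu2
  have IFm : ∀ k, Integrable (fun z : ℝ × UnitAddTorus d => ⟪vseq k z.1 z.2, FunctionSpaces.Torus.timeDeriv ψ z.1 z.2⟫ +
      ⟪vseq k z.1 z.2, FunctionSpaces.Torus.fderiv (ψ z.1) z.2 (vseq k z.1 z.2)⟫ +
      κ k * ⟪vseq k z.1 z.2, FunctionSpaces.Torus.laplacian (ψ z.1) z.2⟫) μT := fun k => hInt (κ k) (hvm k) (hW k).2.1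
  -- the weak momentum identities of the approximants, in product form
  have hzero : ∀ k, ∫ z, (⟪vseq k z.1 z.2, FunctionSpaces.Torus.timeDeriv ψ z.1 z.2⟫ +
      ⟪vseq k z.1 z.2, FunctionSpaces.Torus.fderiv (ψ z.1) z.2 (vseq k z.1 z.2)⟫ +
      κ k * ⟪vseq k z.1 z.2, FunctionSpaces.Torus.laplacian (ψ z.1) z.2⟫) ∂μT = 0 := fun k => by
    rw [integral_prod _ (IFm k)]
    exact (hW k).2.2.2 ψ hψ hdiv
  -- the limit identity, in product form
  suffices hlim : Tendsto (fun k => ∫ z, (⟪vseq k z.1 z.2, FunctionSpaces.Torus.timeDeriv ψ z.1 z.2⟫ +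
      ⟪vseq k z.1 z.2, FunctionSpaces.Torus.fderiv (ψ z.1) z.2 (vseq k z.1 z.2)⟫ +
      κ k * ⟪vseq k z.1 z.2, FunctionSpaces.Torus.laplacian (ψ z.1) z.2⟫) ∂μT) atTop
      (𝓝 (∫ z, (⟪u z.1 z.2, FunctionSpaces.Torus.timeDeriv ψ z.1 z.2⟫ +
        ⟪u z.1 z.2, FunctionSpaces.Torus.fderiv (ψ z.1) z.2 (u z.1 z.2)⟫ +
        0 * ⟪u z.1 z.2, FunctionSpaces.Torus.laplacian (ψ z.1) z.2⟫) ∂μT)) by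
    have h := tendsto_nhds_unique hlim (by simp only [hzero]; exact tendsto_const_nhds)
    change ∫ t in Ioo 0 T, ∫ x, (⟪u t x, FunctionSpaces.Torus.timeDeriv ψ t x⟫ +
      ⟪u t x, FunctionSpaces.Torus.fderiv (ψ t) x (u t x)⟫ + 0 * ⟪u t x, FunctionSpaces.Torus.laplacian (ψ t) x⟫) = 0
    rw [show (∫ t in Ioo 0 T, ∫ x, (⟪u t x, FunctionSpaces.Torus.timeDeriv ψ t x⟫ +
      ⟪u t x, FunctionSpaces.Torus.fderiv (ψ t) x (u t x)⟫ + 0 * ⟪u t x, FunctionSpaces.Torus.laplacian (ψ t) x⟫)) =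
      ∫ z, (⟪u z.1 z.2, FunctionSpaces.Torus.timeDeriv ψ z.1 z.2⟫ +
        ⟪u z.1 z.2, FunctionSpaces.Torus.fderiv (ψ z.1) z.2 (u z.1 z.2)⟫ +
        0 * ⟪u z.1 z.2, FunctionSpaces.Torus.laplacian (ψ z.1) z.2⟫) ∂μT from (integral_prod _ IF).symm]
    exact h
  refine tendsto_integral_of_L1 _ IF.aestronglyMeasurable (Eventually.of_forall IFm) ?_
  -- the `L¹` distance → 0
  have mNb : AEMeasurable (fun z : ℝ × UnitAddTorus d => ‖u z.1 z.2‖ₑ) μT := hum.enorm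
  have mE : ∀ k, AEMeasurable (fun z : ℝ × UnitAddTorus d => ‖vseq k z.1 z.2 - u z.1 z.2‖ₑ) μT :=
    fun k => (show AEStronglyMeasurable (fun z : ℝ × UnitAddTorus d => vseq k z.1 z.2 - u z.1 z.2) μT
      from (hvm k).sub hum).enorm
  have hA : Tendsto (fun k => ∫⁻ z, ‖vseq k z.1 z.2 - u z.1 z.2‖ₑ ^ 2 ∂μT) atTop (𝓝 0) := by
    refine hvconv.congr fun k => ?_
    exact lintegral_Ioo_lintegral_eq_lintegral_prod ((mE k).pow_const _)
  have hN2 : ∫⁻ z, ‖u z.1 z.2‖ₑ ^ 2 ∂μT < ∞ := by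
    have e : ∫⁻ t in Ioo 0 T, ∫⁻ x, ‖u t x‖ₑ ^ 2 = ∫⁻ z, ‖u z.1 z.2‖ₑ ^ 2 ∂μT :=
      lintegral_Ioo_lintegral_eq_lintegral_prod (mNb.pow_const _)
    rw [← e]; exact hu2
  have hκ' : Tendsto (fun k => ‖κ k‖ₑ) atTop (𝓝 0) := by
    have := (continuous_enorm.tendsto (0 : ℝ)).comp hκ0
    rwa [enorm_zero] at this
  have hlim := tendsto_momentumBound (c₁ := ENNReal.ofReal Cdt) (c₂ := ENNReal.ofReal CB)
    (c₃ := ENNReal.ofReal CL) ENNReal.ofReal_ne_top ENNReal.ofReal_ne_top ENNReal.ofReal_ne_top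
    hN2.ne (measure_ne_top μT univ) hA hκ'
  refine tendsto_of_tendsto_of_tendsto_of_le_of_le' tendsto_const_nhds hlim
    (Eventually.of_forall fun _ => zero_le) (Eventually.of_forall fun k => ?_)
  exact lintegral_enorm_momentumFlux_sub_le μT (κ k) bdt bB bL (mE k) mNb

end InviscidLimitMomentum

/-! ## The key identity for one Leray–Hopf solution without defect -/

section Key

variable [DecidableEq d]

/-- **Energy flux of a defect-free Navier–Stokes solution = its viscous dissipation, tested.**
Let `(v, q)` be a distributional Navier–Stokes solution on `T^d × (0,T)`, `ν > 0`, with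
`v ∈ L³_{t,x} ∩ L²_t H¹_x`, `q ∈ L^{3/2}_{t,x}` and *zero* Duchon–Robert defect, and let `G` be
any jointly measurable, slice-wise integrable weak gradient of `v` with `ν|G|² dx dt` finite.
Granted Duchon–Robert's Prop. 2 (`Turb.duchon_robert_defect_exists`: the local energy balance
(10) with the defect `D(v)`) and a.e. uniqueness of weak gradients, the local balance reads,
for every test function `ψ` supported in `(0, T)`,
`∫₀ᵀ∫ [½|v|²∂ₜψ + (½|v|² + q)⟪v, ∇ψ⟫ + ½ν|v|²Δψ] = ∫ ψ d(ν|G|² dx dt)`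
(Duchon–Robert 2000, Prop. 1, local equation of energy, p. 250, with `D(v) = 0`; Drivas–Eyink 2019, (DRloc)). [cite: DuchonRobert2000, Prop. 1 p. 250] -/
theorem energyFlux_eq_integral_dissipationMeasure (hT : 0 ≤ T) {ν : ℝ} (hν : 0 < ν)
    {v : ℝ → UnitAddTorus d → EuclideanSpace ℝ d} {q : ℝ → UnitAddTorus d → ℝ}
    (hP2 : FluidPDE.duchon_robert_defect_exists (T := T) (ν := ν) (u := v) (p := q))
    (hU : HasWeakGradient.unique (d := d))
    (hsol : IsDistributionalNSSolutionOn T ν 0 v q)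
    (hv3 : ∫⁻ t in Ioo 0 T, ∫⁻ x, ‖v t x‖ₑ ^ (3 : ℕ) < ∞)
    (hq32 : ∫⁻ t in Ioo 0 T, ∫⁻ x, ‖q t x‖ₑ ^ (3 / 2 : ℝ) < ∞)
    (hH1 : FunctionSpaces.Torus.MemL2Sobolev 0 T 1 (fun t => FunctionSpaces.EuclideanSpace.complexify ∘ v t))
    (hdef : HasDuchonRobertDefect T v 0)
    {G : ℝ → UnitAddTorus d → EuclideanSpace ℝ d →L[ℝ] EuclideanSpace ℝ d}
    (hGmeas : AEStronglyMeasurable (uncurry G) (volume.restrict (Icc 0 T ×ˢ univ)))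
    (hGae : ∀ᵐ t ∂(volume.restrict (Ioo 0 T)), HasWeakGradient (v t) (G t) ∧ Integrable (G t) volume)
    (hGfin : IsFiniteMeasure (dissipationMeasure ν G T))
    {ψ : ℝ → UnitAddTorus d → ℝ} (hψ : FunctionSpaces.Torus.IsSpaceTimeTestIoo T ψ) :
    ∫ t in Ioo 0 T, ∫ x, (2⁻¹ * ‖v t x‖ ^ 2 * FunctionSpaces.Torus.timeDeriv ψ t x +
        (2⁻¹ * ‖v t x‖ ^ 2 + q t x) * ⟪v t x, FunctionSpaces.Torus.gradient (ψ t) x⟫ +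
        2⁻¹ * ν * ‖v t x‖ ^ 2 * FunctionSpaces.Torus.laplacian (ψ t) x) =
      ∫ z, ψ z.1 z.2 ∂(dissipationMeasure ν G T) := by
  set μT := (volume.restrict (Ioo 0 T)).prod (volume : Measure (UnitAddTorus d)) with hμT
  have hvm : AEStronglyMeasurable (uncurry v) μT := aestronglyMeasurable_uncurry_prod hsol.1
  have hqm : AEStronglyMeasurable (uncurry q) μT := aestronglyMeasurable_uncurry_prod hsol.2.2.1
  -- the guarded mixed classes consumed by Duchon–Robert's Prop. 2
  have hv3' : MemLqLp 3 3 v (Ioo 0 T) := by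
    refine memLqLp_of_lintegral_lt_top three_ne_zero ENNReal.ofNat_ne_top hvm ?_
    have h3 : ∀ x : ℝ≥0∞, x ^ (3 : ℝ≥0∞).toReal = x ^ (3 : ℕ) := fun x => by
      rw [ENNReal.toReal_ofNat, ← ENNReal.rpow_natCast]; norm_num
    simpa only [h3] using hv3
  have hq' : MemLqLp (3 / 2) (3 / 2) q (Ioo 0 T) := by
    refine memLqLp_of_lintegral_lt_top (by norm_num) (ENNReal.div_ne_top ENNReal.ofNat_ne_top
      (by norm_num)) hqm ?_
    have h32 : ((3 / 2 : ℝ≥0∞)).toReal = (3 / 2 : ℝ) := by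
      rw [ENNReal.toReal_div, ENNReal.toReal_ofNat, ENNReal.toReal_ofNat]
    simpa only [h32] using hq32
  -- Duchon–Robert Prop. 2 for `(v, q)`; the defect vanishes by uniqueness
  obtain ⟨Dv, hDv, G', hG', hbal⟩ := hP2 hT hν.le hsol hv3' hq' (fun _ => hH1)
  have hG'' := hG' hν.ne'
  have h0 : Dv ψ = 0 := by
    have := HasDuchonRobertDefect.unique hDv hdef hψ
    simpa using this
  have hb := hbal.2 ψ hψ
  rw [h0] at hb
  -- transfer the balance from `G'` to `G` (a.e. uniqueness of integrable weak gradients)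
  have hb' : ∫ t in Ioo 0 T, ∫ x, (2⁻¹ * ‖v t x‖ ^ 2 * FunctionSpaces.Torus.timeDeriv ψ t x +
        (2⁻¹ * ‖v t x‖ ^ 2 + q t x) * ⟪v t x, FunctionSpaces.Torus.gradient (ψ t) x⟫ +
        2⁻¹ * ν * ‖v t x‖ ^ 2 * FunctionSpaces.Torus.laplacian (ψ t) x -
        ν * weakGradNormSq (G t) x * ψ t x) = 0 := by
    refine Eq.trans (integral_congr_ae ?_) hb
    filter_upwards [hGae, hG''] with t h1 h2
    refine integral_congr_ae ?_
    filter_upwards [hU h2.2 h1.2 h2.1 h1.1] with x hx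
    rw [weakGradNormSq_eq_frobeniusNormSq, weakGradNormSq_eq_frobeniusNormSq, hx]
  -- integrability of both parts, Fubini splitting
  have IA := integrable_energyFluxIntegrand ν hvm hv3 hqm hq32 hψ.isSpaceTimeTest
  obtain ⟨Cψ, hCψ⟩ := hψ.exists_abs_le
  have hψm : AEStronglyMeasurable (uncurry ψ) μT :=
    (hψ.isSpaceTimeTest.isSmoothSpaceTimeOn_derived.1.bound_and_measurable T).2
  have IV : Integrable (fun z : ℝ × UnitAddTorus d =>
      ν * weakGradNormSq (G z.1) z.2 * ψ z.1 z.2) μT :=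
    ((integrable_weakGradNormSq hν hGmeas hGfin).const_mul ν).mul_bdd hψm
      (Eventually.of_forall fun z => by simpa [Real.norm_eq_abs] using hCψ z.1 z.2)
  have hsplit : ∫ t in Ioo 0 T, ∫ x, (2⁻¹ * ‖v t x‖ ^ 2 * FunctionSpaces.Torus.timeDeriv ψ t x +
        (2⁻¹ * ‖v t x‖ ^ 2 + q t x) * ⟪v t x, FunctionSpaces.Torus.gradient (ψ t) x⟫ +
        2⁻¹ * ν * ‖v t x‖ ^ 2 * FunctionSpaces.Torus.laplacian (ψ t) x -
        ν * weakGradNormSq (G t) x * ψ t x) =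
      (∫ t in Ioo 0 T, ∫ x, (2⁻¹ * ‖v t x‖ ^ 2 * FunctionSpaces.Torus.timeDeriv ψ t x +
        (2⁻¹ * ‖v t x‖ ^ 2 + q t x) * ⟪v t x, FunctionSpaces.Torus.gradient (ψ t) x⟫ +
        2⁻¹ * ν * ‖v t x‖ ^ 2 * FunctionSpaces.Torus.laplacian (ψ t) x)) -
      ∫ t in Ioo 0 T, ∫ x, ν * weakGradNormSq (G t) x * ψ t x := by
    rw [← integral_sub IA.integral_prod_left IV.integral_prod_left]
    refine integral_congr_ae ?_
    filter_upwards [IA.prod_right_ae, IV.prod_right_ae] with t hA hV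
    exact integral_sub hA hV
  rw [hsplit, sub_eq_zero] at hb'
  rw [hb', integral_dissipationMeasure_eq hν hGmeas hGfin hψm ⟨Cψ, hCψ⟩]

end Key

/-! ## The reduction -/

/-- **Duchon–Robert 2000, Prop. 4 (proof, p. 253), assembled from its printed ingredients.** Granted
(A1) the `L^{3/2}` pressure and its continuity (`exists_pressure_of_tendsto_L3`; DR Prop. 1,
Robinson–Rodrigo–Sadowski 2016 Lemma 5.1 / Prop. 5.3), (P2) Duchon–Robert's Prop. 2
(`Turb.duchon_robert_defect_exists`) and (U) a.e. uniqueness of weak gradients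
(`HasWeakGradient.unique`), the fact `IsDissipationMeasureOf.hasDuchonRobertDefect` holds; the
other two printed ingredients, (A2) continuity of the energy flux pairing
(`tendsto_energyFlux_of_tendsto_L3`) and (A3) that strong inviscid limits are weak Euler
solutions (`isWeakEulerSolutionOn_of_inviscidLimit`), are proved above.
Proof (Duchon–Robert 2000, proof of Prop. 4; Drivas–Eyink 2019, §2): fix a mollifier `φ` and a
test `ψ` supported in `(0,T)` (for `T ≤ 0`, `ψ = 0`). By (A3) and (A1) there are pressures
`p_m → p` in `L^{3/2}` with `(u_m, p_m)`, `(u, p)` distributional solutions. For `m` large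
(`ν_m > 0`, `u_m ∈ L³`), (P2) for `(u_m, p_m)`, uniqueness of the defect
(`HasDuchonRobertDefect.unique`) and `D(u_m) = 0` give the local balance with zero defect, whose
gradient witness is exchanged for the one of the dissipation measure by (U); Fubini then
identifies the energy flux `E_m(ψ)` with `∫ ψ d(ν_m|∇u_m|² dx dt)`
(`energyFlux_eq_integral_dissipationMeasure`), which tends to `∫ ψ dD` by weak convergence of the
dissipation measures, while `E_m(ψ) → E(ψ)` by (A2); so `E(ψ) = ∫ ψ dD`. Finally (P2) for the
Euler solution `(u, p)` yields `D(u)` with `D_ε(u) → D(u)` and `D(u)(ψ) = E(ψ) = ∫ ψ dD`. [cite: DuchonRobert2000, Prop. 4 and its proof p. 253] -/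
theorem IsDissipationMeasureOf.hasDuchonRobertDefect_of
    (hA1 : exists_pressure_of_tendsto_L3 (T := T) (u := u))
    (hP2 : ∀ [DecidableEq d] {ν : ℝ} {v : ℝ → UnitAddTorus d → EuclideanSpace ℝ d}
      {p : ℝ → UnitAddTorus d → ℝ},
      FluidPDE.duchon_robert_defect_exists (T := T) (ν := ν) (u := v) (p := p))
    (hU : HasWeakGradient.unique (d := d)) :
    IsDissipationMeasureOf.hasDuchonRobertDefect (T := T) (u := u) := by
  intro _ νseq useq D hD hν hLH hdef hmeas hL3 hu3 φ hφ ψ hψ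
  -- degenerate time intervals: the test function vanishes identically
  rcases le_or_gt T 0 with hT | hT
  · have h0 : ∀ t, ψ t = 0 := hψ.eq_zero_of_nonpos hT
    have h1 : (fun ε => ∫ t in Ioo 0 T, ∫ x, duchonRobertApprox φ ε (u t) x * ψ t x) =
        fun _ => 0 := by
      funext ε
      simp [h0]
    have h2 : STFunctional.ofMeasure D ψ = 0 := by
      simp [STFunctional.ofMeasure, h0]
    rw [h1, h2]
    exact tendsto_const_nhds
  set μT := (volume.restrict (Ioo 0 T)).prod (volume : Measure (UnitAddTorus d)) with hμT
  -- the Leray–Hopf solutions are pressure-free weak solutions on `(0, T)`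
  have hW : ∀ m, FunctionSpaces.Torus.IsWeakNSSolutionOn T (νseq m) (useq m) := fun m => by
    obtain ⟨u₀, h⟩ := hLH m
    exact h.isWeakNSSolutionWithDataOn.isWeakNSSolutionOn
  have hWm : ∀ m, AEStronglyMeasurable (uncurry (useq m)) μT := fun m =>
    aestronglyMeasurable_uncurry_prod (hW m).1
  have hum : AEStronglyMeasurable (uncurry u) μT := aestronglyMeasurable_uncurry_prod hmeas
  have hν0 : Tendsto νseq atTop (𝓝 0) := tendsto_nhds_of_tendsto_nhdsWithin hν
  have hνpos : ∀ᶠ m in atTop, 0 < νseq m := (tendsto_nhdsWithin_iff.1 hν).2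
  -- `L³` convergence gives `L²` convergence and `u ∈ L²`
  have hdiff : ∀ m, AEStronglyMeasurable (uncurry fun t x => useq m t x - u t x) μT := fun m =>
    (hWm m).sub hum
  have hL2 : Tendsto (fun m => ∫⁻ t in Ioo 0 T, ∫⁻ x, ‖useq m t x - u t x‖ₑ ^ 2) atTop (𝓝 0) :=
    tendsto_lintegral_enorm_sq (Eventually.of_forall hdiff) hL3
  have hu2 : ∫⁻ t in Ioo 0 T, ∫⁻ x, ‖u t x‖ₑ ^ 2 < ∞ :=
    lt_of_le_of_lt (lintegral_enorm_sq_le hum) (ENNReal.mul_lt_top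
      (ENNReal.rpow_lt_top_of_nonneg (by norm_num) ENNReal.ofReal_ne_top)
      (ENNReal.rpow_lt_top_of_nonneg (by norm_num) hu3.ne))
  -- (A3) the limit is a weak Euler solution
  have hE : FunctionSpaces.Torus.IsWeakEulerSolutionOn T u :=
    isWeakEulerSolutionOn_of_inviscidLimit hν0 (Eventually.of_forall hW) hmeas hu2 hL2
  -- (A1) pressures
  obtain ⟨pseq, p, hpev, hdist, hp32, hpconv⟩ := hA1 (Eventually.of_forall hW) hE hL3 hu3
  -- (A2) the energy fluxes converge
  have hflux := tendsto_energyFlux_of_tendsto_L3 hν0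
    (hpev.mono fun m hm => ⟨(hW m).1, hm.1.2.2.1⟩) hmeas hdist.2.2.1 hL3 hu3 hpconv hp32 hψ
  -- the dissipation measures
  obtain ⟨Gseq, hGmeas, hGae, hGfin, hDfin, hGlim⟩ := hD
  have hlimD := hGlim hψ.toBCF
  simp only [FunctionSpaces.Torus.IsSpaceTimeTestIoo.toBCF_apply] at hlimD
  -- eventually, the energy flux of `u_m` is the pairing of `ψ` with `ν_m |∇u_m|²`
  have hu3m : ∀ᶠ m in atTop, ∫⁻ t in Ioo 0 T, ∫⁻ x, ‖useq m t x‖ₑ ^ (3 : ℕ) < ∞ :=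
    eventually_lintegral_enorm_pow_three_lt_top (Eventually.of_forall hWm) hum hL3 hu3
  have hkey : ∀ᶠ m in atTop, ∫ t in Ioo 0 T, ∫ x,
      (2⁻¹ * ‖useq m t x‖ ^ 2 * FunctionSpaces.Torus.timeDeriv ψ t x +
        (2⁻¹ * ‖useq m t x‖ ^ 2 + pseq m t x) * ⟪useq m t x, FunctionSpaces.Torus.gradient (ψ t) x⟫ +
        2⁻¹ * νseq m * ‖useq m t x‖ ^ 2 * FunctionSpaces.Torus.laplacian (ψ t) x) =
      ∫ z, ψ z.1 z.2 ∂(dissipationMeasure (νseq m) (Gseq m) T) := by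
    filter_upwards [hνpos, hpev, hu3m] with m hνm hpm h3m
    obtain ⟨u₀, hLHm⟩ := hLH m
    exact energyFlux_eq_integral_dissipationMeasure hT.le hνm hP2 hU hpm.1 h3m hpm.2
      hLHm.memL2Sobolev (hdef m) (hGmeas m) (hGae m) (hGfin m) hψ
  have hlim1 := hlimD.congr' (EventuallyEq.symm hkey)
  have hEq := tendsto_nhds_unique hflux hlim1
  -- Duchon–Robert Prop. 2 for the limit `(u, p)` (Euler): its defect is the limit flux
  have hu3' : MemLqLp 3 3 u (Ioo 0 T) := by
    refine memLqLp_of_lintegral_lt_top three_ne_zero ENNReal.ofNat_ne_top hum ?_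
    have h3 : ∀ x : ℝ≥0∞, x ^ (3 : ℝ≥0∞).toReal = x ^ (3 : ℕ) := fun x => by
      rw [ENNReal.toReal_ofNat, ← ENNReal.rpow_natCast]; norm_num
    simpa only [h3] using hu3
  have hp' : MemLqLp (3 / 2) (3 / 2) p (Ioo 0 T) := by
    refine memLqLp_of_lintegral_lt_top (by norm_num) (ENNReal.div_ne_top ENNReal.ofNat_ne_top
      (by norm_num)) (aestronglyMeasurable_uncurry_prod hdist.2.2.1) ?_
    have h32 : ((3 / 2 : ℝ≥0∞)).toReal = (3 / 2 : ℝ) := by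
      rw [ENNReal.toReal_div, ENNReal.toReal_ofNat, ENNReal.toReal_ofNat]
    simpa only [h32] using hp32
  obtain ⟨Du, hDu, G₀, -, hbal0⟩ := hP2 hT.le le_rfl hdist hu3' hp' (fun h => (h rfl).elim)
  have hb0 := hbal0.2 ψ hψ
  simp only [mul_zero, zero_mul, add_zero, sub_zero] at hb0
  -- conclusion
  have hfinal : STFunctional.ofMeasure D ψ = Du ψ := by
    rw [← hb0, hEq]
    rfl
  rw [hfinal]
  exact hDu φ hφ ψ hψ

end Literature.Analysis.FluidPDE.Torus
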